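import Summits.ValiantsHypothesis.ValiantsHypothesis.Theorems.PolyaContinuedLaplaceRigidityStrength
import Summits.ValiantsHypothesis.ValiantsHypothesis.Theorems.SymPencilPerFourSingularLocusSupportMonomials
import Summits.ValiantsHypothesis.ValiantsHypothesis.Theorems.SymPencilPerFourSingularLocusSupportPatterns
import Literature.Computability.AlgebraicComplexity.ABV17SingPermThreeCodim
import Literature.LinearAlgebra.Matrix.PermanentSubperm
import Literature.LinearAlgebra.Matrix.PermanentBooleanSum
import Literature.LinearAlgebra.Matrix.AdjugateEigenvectors
import HarnessLib

/-!
# Line `sing_height_cascade` v2.3 — crux `CoverDecancellation` (stmt-ValiantsHypothesis-17819),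
  rung `StrengthTwoPerFourGeFour` («str₂(per₄) ≥ 4»: `per₄` is not a sum of three products of
  two quadrics) via «codim Sing(per₄) ≥ 7», RE-CUT after RULING g12-R132 (a)

Ideator seat `val-idea-18` (lens = cascade), g1 2026-08-28 05:53Z, **v2 (g2) 2026-08-28**.  NOT a
registered skeleton (ideator budget: no `ledger skeleton check`); published with
`ledger crux write … Lines/sing_height_cascade.lean|.md`.  Line owner (R125 (a)): val-idea-18.

**STATUS v2.3.1 (g2, 2026-08-28 08:45Z; v2.3.1 = v2.3 + lint: 3 `omit [IsDomain L] in`, 9 unused binders `_`-prefixed, statements unchanged): ALL ELEVEN STUBS ARE PROVED — this file has NO `sorry`.**  NZ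
`stub_noZeroLine_zeros` is closed BY NAME from the LANDED helper
`Theorems/SymPencilPerFourSingularLocusSupportPatterns.support_of_subperm_vanish` (val-idea-10 g2,
accepted 2026-08-28 08:09Z; R132 (a)) through the proved reduction `noZeroLine_zeros_of_support`;
C0 `stub_compound_mulVec` from the landed `…SupportMonomials.subperm_three_explicit` (by name); T1
`stub_subpermVanish_transpose`, T2 `stub_height_transpose`, KL `stub_kerline` (via the tree's
`AdjugateEigenvectors.exists_adjugate_sub_smul_eq_vecMulVec` over the fraction field), CL
`stub_rankTwo_classification` (three `3 × 3` minors of the adjugate + the `P/d` identities,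
transported by `S₄`), and the five leaves Z.R3 `stub_Z_kerline` (kernel-line witnesses
`X_(t,l)·adj_mk − X_(t,m)·adj_lk`), Z.B0 `stub_Z_compoundZero`, Z.S2 `stub_Z_S2`, Z.S1a `stub_Z_S1a`,
Z.K `stub_Z_K` (explicit vzG chains, §1b tools) are proved in this file (v2.1/v2.2).  FINAL OUTPUTS
(sorry-free): `strengthTwoPerFourGeFour_holds : StrengthTwoPerFourGeFour` («str₂(per₄) ≥ 4») and
`seven_le_height_singIdeal_perPoly_four : 7 ≤ (singIdeal (perPoly (Fin 4) ℂ)).height`; also kept: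
`strengthTwoPerFourGeFour_of_support : (∀ L, SupportTheorem L) → StrengthTwoPerFourGeFour` (v2.2).
This is a crux WORKFILE, not a landing: lifting it to `Theorems/` is a port/prover seat's job
(R125 (a)); an independent workfile-level closure of h7 is val-idea-10 g2's
`Lines/sing_per4_height.lean` (Parts A+B+C).  Names and signatures of all eleven stubs and the `_of`
shape are UNCHANGED from v2 @70f5461188db.

HONEST FRAMING.  Target = ONE typed lower rung of the HELD residual crux `CoverDecancellation`
(«PRICE P1, lower rung» of line `laplace_rigidity`); the landed helper
`Theorems/PolyaContinuedLaplaceRigidityStrength.lean` reduces it, BY NAME, to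
`7 ≤ (singIdeal (perPoly (Fin 4) ℂ)).height`.  Nothing here touches `CoverDecancellation` itself,
the width-5 rung `StrengthTwoPerFour` (stmt-25160), or VP ≠ VNP; no summit statement is proved by
this file.  METHOD CEILING: `codim Sing(per_n) ≤ 2n` (`alperBogartVelasco2017_rem_1_5`).

## v2 = the R132 re-cut (what changed since v1 @63e5c438a2e3)

* The three no-zero-line stubs of v1 (`stub_compoundZero`, `stub_rankTwo`, `stub_rankThree`) and the
  transcendence-degree currency `stub_height_ge_of_isAlgebraic` (C1, crit-5's «cost centre») are
  DELETED.  The whole no-zero-line regime is ONE stub `stub_noZeroLine_zeros` («no zero row/column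
  ⇒ at least 8 zero COORDINATES»), to be closed BY NAME from val-idea-10 g2's SUPPORT THEOREM
  (R132 (a): «all sixteen 3×3 sub-permanents vanish ⇒ 12·m₁(M) = 12·m₂(M) = 0»,
  `m₁ = x₀₂x₀₃x₁₁³x₂₀x₃₀³`, `m₂ = x₀₀x₀₁x₀₃x₁₂²x₂₁²x₃₀²`, exact cofactor identities over any
  commutative ring, + the hitting-set cover: a singular matrix with no zero line has an ANTI-BLOCK
  zero pattern `I×J ∪ Iᶜ×Jᶜ`, `|J| = 2` (8 zeros) or CROSS support `⊆ row i ∪ col j` (9 zeros)),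
  filed by its author as a `Theorems/` helper `--supports stmt-ValiantsHypothesis-17819`.  Zeros are
  height in the tree's own currency `VonZurGathen.card_le_height_ker_aeval`; the glue is PROVED.
  Independent corroboration from this line's v1 algebra: over `F₅`/`F₇`, 429 sampled singular points
  without zero line — every one is anti-block (leaf K₂₂ / MIXED-on-two-columns, exactly 8 zeros) or
  cross (≥ 9 zeros), 0 exceptions (`compute/nzl_check.py`); the v1 sub-cascade B0/R2/R3 (chain
  table in `Lines/sing_height_cascade.md` §B) remains the documented FALLBACK for this stub.
* CHARACTERISTIC.  The support theorem needs `12 ≠ 0`; so the cascade's field hypothesis is now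
  `(2 : K) ≠ 0 ∧ (3 : K) ≠ 0` (the `ℂ` assembly is unchanged).  This is genuine: in characteristic 3
  every rank-one matrix is singular for `per₄` (`per J₃ = 6 = 0`) — a 7-dimensional family with no
  zero coordinate (v1's leaf «all rows proportional»); `h ≥ 7` still holds there, but not by zeros.
* WHAT REMAINS = THE ZERO-LINE BRANCH (`seven_le_height_of_zeroRow`, dispatch PROVED below), cut
  into explicit CHAIN leaves in the landed vzG currency (`height_ker_aeval_piecewise_insert`,
  `height_ker_aeval_piecewise_add_card_le`, `aeval_blockWitness_of_notMem/mem`,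
  `X_mul_C_add_C_ne_zero`): free the zero coordinates first, then ≤ 3 witnesses whose supports are
  disjoint from everything freed earlier (so `h0` is «value at `a`», `h1` is «`X·C u + C w`, `u ≠ 0`»):
    Z0   two zero rows                      8 zeros                                    PROVED here
    Z.R3 `adj B(u,v) ≠ 0`                   4 zeros + 3 kernel-line steps              `stub_Z_kerline`
    Z.B0 `B(u,v) = 0`, `u_e ≠ 0`            4 zeros + 3 steps `p_{ef}(X_r,X_s)`, f ≠ e `stub_Z_compoundZero`
    Z.S2 `u_j = v_j = 0`, arm `B_{jc} ≠ 0`  7 zeros (row w ∪ column j; `y_j = 0` forced) `stub_Z_S2`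
    Z.S1a `u_j ≠ 0`, STAR(j), arm `≠ 0`     4 zeros + subperm step (lead = arm) + 3 steps `p_{jx}` (lead `u_j`) = 8   `stub_Z_S1a`
    Z.K  K₂₂: `u_α = u_β = 0`, `p_{γδ} = 0`  6 zeros + 1 step `p_{γδ}(X_r,X_s)` (lead `u_γ` or `u_δ`) `stub_Z_K`
  (`u,v,y` = the three other rows, `B(u,v)` = `compound u v`; supports: rank-two classification
  `stub_rankTwo_classification` (char ≠ 2), kernel-line identity `stub_kerline` (all 4×4 matrices),
  transposition `stub_subpermVanish_transpose` / `stub_height_transpose`, C0 `stub_compound_mulVec`).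
  MECHANICAL CERTIFICATE of the tree and of every chain (static rule / vanishing / linearity / lead
  ≠ 0 / length ≥ 7): `F₃` EXHAUSTIVE — all 237 249 points of Sing(per₄)(F₃); `F₅` 30 105 and `F₇`
  46 518 stratified points; 0 failures (`compute/cascade.py`, `compute/sample_strata.py`, hub-local,
  < 60 cpu-s per run).  Identities checked in exact arithmetic (`compute/identities.py`): C0, the
  kernel-line identity `adj_{μκ}y_λ − adj_{λκ}y_μ = Σ_{j≠κ} ±(2×2 minor of B)·(By)_j` (ALL 4×4 `B`),
  `p_αγ p_βδ − p_αδ p_βγ = −d_αβ d_γδ`, the 3×3 minors of a symmetric zero-diagonal matrix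
  (principal `2b_ij b_jk b_ik`, non-principal `b_ij(b_ik b_jl + b_il b_jk − b_ij b_kl)`).
* `seven_le_height_of_vanishing_of` now has shape `(hZ) (hNZ)`; defs `row`, `compound`,
  `SubpermVanish`, `HasZeroLine` and stub C0 `stub_compound_mulVec` are VERBATIM v1 (the defs-file /
  C0 port keyed by R125 (a) P3 is unaffected).

In print: «it can be readily computed that codim(Sing(perm₄)) = 8» (Alper–Bogart–Velasco 2017 §1,
Macaulay2; c.f. von zur Gathen 1987); `ABV17SingPermThreeCodim.lean` lists the `4 × 4` clause as NOT
TYPED.  Only `≥ 7` is claimed here (the true value 8 is visible: every leaf above has slack ≥ 1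
except Z.K, Z.B0, Z.R3 at exactly 7 — and those sit inside 8-dimensional components only
generically).
-/

-- single-conjunct layout: Sub = Summit, duplicated namespace component intended
set_option linter.dupNamespace false

noncomputable section

namespace Summit.ValiantsHypothesis.ValiantsHypothesis.Cruxes.CoverDecancellation.SingHeightCascade

open MvPolynomial Matrix
open Literature.Computability.AlgebraicComplexity
open Literature.Computability.AlgebraicComplexity.VonZurGathen
open Literature.Computability.AlgebraicComplexity.BoraleviCarliniMichalekVentura2025
open Summit.ValiantsHypothesis.ValiantsHypothesis.Theorems.SymPencilPerFourSingularLocusSupportMonomials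
  (subperm_three_explicit)
open Summit.ValiantsHypothesis.ValiantsHypothesis.Theorems.PolyaContinuedLaplaceRigidity.Strength

section Cascade

variable {K : Type*} [Field K] {L : Type*} [CommRing L] [IsDomain L] [Algebra K L]

/-! ### §0 Definitions (VERBATIM v1) -/

/-- Row `r` of a point `a : 4 × 4 → L`. -/
def row (a : Fin 4 × Fin 4 → L) (r : Fin 4) : Fin 4 → L := fun c => a (r, c)

/-- The **permanental compound** of two rows: `B(u,v)_{jc} = u_e v_f + u_f v_e` where `{e,f}` is
the complement of `{j,c}` (written as the sum over ORDERED pairs `(e,f)` avoiding `j,c`, which is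
exactly `u_e v_f + u_f v_e`), and `B_{jj} = 0`.  Symmetric, zero diagonal; entry `(j,c)` is the
`2 × 2` permanent of the rows `u,v` on the two columns other than `j,c`. -/
def compound (u v : Fin 4 → L) : Matrix (Fin 4) (Fin 4) L :=
  Matrix.of fun j c => if j = c then 0 else
    ∑ e, ∑ f, if e ≠ j ∧ e ≠ c ∧ f ≠ j ∧ f ≠ c ∧ e ≠ f then u e * v f else 0

/-- All sixteen `3 × 3` subpermanents vanish at `a` (the hypothesis shape of
`VonZurGathen.five_le_height_of_vanishing`; `subperm p q`: `p` = kept columns, `q` = kept rows). -/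
def SubpermVanish (a : Fin 4 × Fin 4 → L) : Prop :=
  ∀ r c, (Matrix.of fun r c => a (r, c)).subperm (· ≠ c) (· ≠ r) = 0

/-- Some row or some column of `a` is identically zero. -/
def HasZeroLine (a : Fin 4 × Fin 4 → L) : Prop :=
  (∃ r, ∀ c, a (r, c) = 0) ∨ (∃ c, ∀ r, a (r, c) = 0)

/-! ### §0b Tools for C0 and NZ (PROVED, v2.2): case enumerators, the explicit compound
matrix and its action on a vector, the minor form of `SubpermVanish` (the hypothesis shape of the
landed helper `Theorems/SymPencilPerFourSingularLocusSupportMonomials.lean`, val-idea-10 g2). -/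

private theorem fin4_cases : ∀ x : Fin 4, x = 0 ∨ x = 1 ∨ x = 2 ∨ x = 3 := by decide

private theorem exists_fourth : ∀ r s t : Fin 4, ∃ w, w ≠ r ∧ w ≠ s ∧ w ≠ t := by decide

omit [IsDomain L] in
theorem compound_explicit (u v : Fin 4 → L) : compound u v = !![
    0, u 2 * v 3 + u 3 * v 2, u 1 * v 3 + u 3 * v 1, u 1 * v 2 + u 2 * v 1;
    u 2 * v 3 + u 3 * v 2, 0, u 0 * v 3 + u 3 * v 0, u 0 * v 2 + u 2 * v 0;
    u 1 * v 3 + u 3 * v 1, u 0 * v 3 + u 3 * v 0, 0, u 0 * v 1 + u 1 * v 0;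
    u 1 * v 2 + u 2 * v 1, u 0 * v 2 + u 2 * v 0, u 0 * v 1 + u 1 * v 0, 0] := by
  ext j c
  fin_cases j <;> fin_cases c <;> simp [compound, Fin.sum_univ_four]

omit [IsDomain L] in
theorem compound_mulVec_apply_zero (u v x : Fin 4 → L) :
    (compound u v *ᵥ x) 0 = (u 2 * v 3 + u 3 * v 2) * x 1 + (u 1 * v 3 + u 3 * v 1) * x 2 + (u 1 * v 2 + u 2 * v 1) * x 3 := by
  rw [compound_explicit]; simp [Matrix.mulVec, dotProduct, Fin.sum_univ_four]

omit [IsDomain L] in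
theorem compound_mulVec_apply_one (u v x : Fin 4 → L) :
    (compound u v *ᵥ x) 1 = (u 2 * v 3 + u 3 * v 2) * x 0 + (u 0 * v 3 + u 3 * v 0) * x 2 + (u 0 * v 2 + u 2 * v 0) * x 3 := by
  rw [compound_explicit]; simp [Matrix.mulVec, dotProduct, Fin.sum_univ_four]

omit [IsDomain L] in
theorem compound_mulVec_apply_two (u v x : Fin 4 → L) :
    (compound u v *ᵥ x) 2 = (u 1 * v 3 + u 3 * v 1) * x 0 + (u 0 * v 3 + u 3 * v 0) * x 1 + (u 0 * v 1 + u 1 * v 0) * x 3 := by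
  rw [compound_explicit]; simp [Matrix.mulVec, dotProduct, Fin.sum_univ_four]

omit [IsDomain L] in
theorem compound_mulVec_apply_three (u v x : Fin 4 → L) :
    (compound u v *ᵥ x) 3 = (u 1 * v 2 + u 2 * v 1) * x 0 + (u 0 * v 2 + u 2 * v 0) * x 1 + (u 0 * v 1 + u 1 * v 0) * x 2 := by
  rw [compound_explicit]; simp [Matrix.mulVec, dotProduct, Fin.sum_univ_four]

private theorem perm_cases0 : ∀ r s t : Fin 4, 0 ≠ r → 0 ≠ s → 0 ≠ t → r ≠ s → r ≠ t →
    s ≠ t → (r = 1 ∧ s = 2 ∧ t = 3) ∨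
    (r = 1 ∧ s = 3 ∧ t = 2) ∨
    (r = 2 ∧ s = 1 ∧ t = 3) ∨
    (r = 2 ∧ s = 3 ∧ t = 1) ∨
    (r = 3 ∧ s = 1 ∧ t = 2) ∨
    (r = 3 ∧ s = 2 ∧ t = 1) := by
  intro r s t h1 h2 h3 h4 h5 h6
  rcases fin4_cases r with rfl | rfl | rfl | rfl <;> rcases fin4_cases s with rfl | rfl | rfl | rfl <;>
    rcases fin4_cases t with rfl | rfl | rfl | rfl
  all_goals first
    | exact absurd rfl h1
    | exact absurd rfl h2
    | exact absurd rfl h3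
    | exact absurd rfl h4
    | exact absurd rfl h5
    | exact absurd rfl h6
    | decide

private theorem perm_cases1 : ∀ r s t : Fin 4, 1 ≠ r → 1 ≠ s → 1 ≠ t → r ≠ s → r ≠ t →
    s ≠ t → (r = 0 ∧ s = 2 ∧ t = 3) ∨
    (r = 0 ∧ s = 3 ∧ t = 2) ∨
    (r = 2 ∧ s = 0 ∧ t = 3) ∨
    (r = 2 ∧ s = 3 ∧ t = 0) ∨
    (r = 3 ∧ s = 0 ∧ t = 2) ∨
    (r = 3 ∧ s = 2 ∧ t = 0) := by
  intro r s t h1 h2 h3 h4 h5 h6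
  rcases fin4_cases r with rfl | rfl | rfl | rfl <;> rcases fin4_cases s with rfl | rfl | rfl | rfl <;>
    rcases fin4_cases t with rfl | rfl | rfl | rfl
  all_goals first
    | exact absurd rfl h1
    | exact absurd rfl h2
    | exact absurd rfl h3
    | exact absurd rfl h4
    | exact absurd rfl h5
    | exact absurd rfl h6
    | decide

private theorem perm_cases2 : ∀ r s t : Fin 4, 2 ≠ r → 2 ≠ s → 2 ≠ t → r ≠ s → r ≠ t →
    s ≠ t → (r = 0 ∧ s = 1 ∧ t = 3) ∨
    (r = 0 ∧ s = 3 ∧ t = 1) ∨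
    (r = 1 ∧ s = 0 ∧ t = 3) ∨
    (r = 1 ∧ s = 3 ∧ t = 0) ∨
    (r = 3 ∧ s = 0 ∧ t = 1) ∨
    (r = 3 ∧ s = 1 ∧ t = 0) := by
  intro r s t h1 h2 h3 h4 h5 h6
  rcases fin4_cases r with rfl | rfl | rfl | rfl <;> rcases fin4_cases s with rfl | rfl | rfl | rfl <;>
    rcases fin4_cases t with rfl | rfl | rfl | rfl
  all_goals first
    | exact absurd rfl h1
    | exact absurd rfl h2
    | exact absurd rfl h3
    | exact absurd rfl h4
    | exact absurd rfl h5
    | exact absurd rfl h6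
    | decide

private theorem perm_cases3 : ∀ r s t : Fin 4, 3 ≠ r → 3 ≠ s → 3 ≠ t → r ≠ s → r ≠ t →
    s ≠ t → (r = 0 ∧ s = 1 ∧ t = 2) ∨
    (r = 0 ∧ s = 2 ∧ t = 1) ∨
    (r = 1 ∧ s = 0 ∧ t = 2) ∨
    (r = 1 ∧ s = 2 ∧ t = 0) ∨
    (r = 2 ∧ s = 0 ∧ t = 1) ∨
    (r = 2 ∧ s = 1 ∧ t = 0) := by
  intro r s t h1 h2 h3 h4 h5 h6
  rcases fin4_cases r with rfl | rfl | rfl | rfl <;> rcases fin4_cases s with rfl | rfl | rfl | rfl <;>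
    rcases fin4_cases t with rfl | rfl | rfl | rfl
  all_goals first
    | exact absurd rfl h1
    | exact absurd rfl h2
    | exact absurd rfl h3
    | exact absurd rfl h4
    | exact absurd rfl h5
    | exact absurd rfl h6
    | decide

omit [IsDomain L] in
/-- C0 with the deleted row `0` fixed: the four cubics deleting row `0` give
`B(a_r,a_s) a_t = 0` for every ordering `(r,s,t)` of the other three rows. -/
private theorem c0_row0 (a : Fin 4 × Fin 4 → L)
    (e0 : a (1, 1) * (a (2, 2) * a (3, 3) + a (2, 3) * a (3, 2)) + a (1, 2) * (a (2, 1) * a (3, 3) + a (2, 3) * a (3, 1)) + a (1, 3) * (a (2, 1) * a (3, 2) + a (2, 2) * a (3, 1)) = 0)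
    (e1 : a (1, 0) * (a (2, 2) * a (3, 3) + a (2, 3) * a (3, 2)) + a (1, 2) * (a (2, 0) * a (3, 3) + a (2, 3) * a (3, 0)) + a (1, 3) * (a (2, 0) * a (3, 2) + a (2, 2) * a (3, 0)) = 0)
    (e2 : a (1, 0) * (a (2, 1) * a (3, 3) + a (2, 3) * a (3, 1)) + a (1, 1) * (a (2, 0) * a (3, 3) + a (2, 3) * a (3, 0)) + a (1, 3) * (a (2, 0) * a (3, 1) + a (2, 1) * a (3, 0)) = 0)
    (e3 : a (1, 0) * (a (2, 1) * a (3, 2) + a (2, 2) * a (3, 1)) + a (1, 1) * (a (2, 0) * a (3, 2) + a (2, 2) * a (3, 0)) + a (1, 2) * (a (2, 0) * a (3, 1) + a (2, 1) * a (3, 0)) = 0)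
    {r s t : Fin 4} (h : (r = 1 ∧ s = 2 ∧ t = 3) ∨
    (r = 1 ∧ s = 3 ∧ t = 2) ∨
    (r = 2 ∧ s = 1 ∧ t = 3) ∨
    (r = 2 ∧ s = 3 ∧ t = 1) ∨
    (r = 3 ∧ s = 1 ∧ t = 2) ∨
    (r = 3 ∧ s = 2 ∧ t = 1)) :
    compound (row a r) (row a s) *ᵥ row a t = 0 := by
  funext j
  rcases fin4_cases j with rfl | rfl | rfl | rfl
  · rcases h with ⟨rfl, rfl, rfl⟩ | ⟨rfl, rfl, rfl⟩ | ⟨rfl, rfl, rfl⟩ | ⟨rfl, rfl, rfl⟩ |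
      ⟨rfl, rfl, rfl⟩ | ⟨rfl, rfl, rfl⟩
    all_goals (rw [Pi.zero_apply, compound_mulVec_apply_zero]; simp only [row]; linear_combination e0)
  · rcases h with ⟨rfl, rfl, rfl⟩ | ⟨rfl, rfl, rfl⟩ | ⟨rfl, rfl, rfl⟩ | ⟨rfl, rfl, rfl⟩ |
      ⟨rfl, rfl, rfl⟩ | ⟨rfl, rfl, rfl⟩
    all_goals (rw [Pi.zero_apply, compound_mulVec_apply_one]; simp only [row]; linear_combination e1)
  · rcases h with ⟨rfl, rfl, rfl⟩ | ⟨rfl, rfl, rfl⟩ | ⟨rfl, rfl, rfl⟩ | ⟨rfl, rfl, rfl⟩ |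
      ⟨rfl, rfl, rfl⟩ | ⟨rfl, rfl, rfl⟩
    all_goals (rw [Pi.zero_apply, compound_mulVec_apply_two]; simp only [row]; linear_combination e2)
  · rcases h with ⟨rfl, rfl, rfl⟩ | ⟨rfl, rfl, rfl⟩ | ⟨rfl, rfl, rfl⟩ | ⟨rfl, rfl, rfl⟩ |
      ⟨rfl, rfl, rfl⟩ | ⟨rfl, rfl, rfl⟩
    all_goals (rw [Pi.zero_apply, compound_mulVec_apply_three]; simp only [row]; linear_combination e3)

omit [IsDomain L] in
/-- C0 with the deleted row `1` fixed: the four cubics deleting row `1` give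
`B(a_r,a_s) a_t = 0` for every ordering `(r,s,t)` of the other three rows. -/
private theorem c0_row1 (a : Fin 4 × Fin 4 → L)
    (e0 : a (0, 1) * (a (2, 2) * a (3, 3) + a (2, 3) * a (3, 2)) + a (0, 2) * (a (2, 1) * a (3, 3) + a (2, 3) * a (3, 1)) + a (0, 3) * (a (2, 1) * a (3, 2) + a (2, 2) * a (3, 1)) = 0)
    (e1 : a (0, 0) * (a (2, 2) * a (3, 3) + a (2, 3) * a (3, 2)) + a (0, 2) * (a (2, 0) * a (3, 3) + a (2, 3) * a (3, 0)) + a (0, 3) * (a (2, 0) * a (3, 2) + a (2, 2) * a (3, 0)) = 0)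
    (e2 : a (0, 0) * (a (2, 1) * a (3, 3) + a (2, 3) * a (3, 1)) + a (0, 1) * (a (2, 0) * a (3, 3) + a (2, 3) * a (3, 0)) + a (0, 3) * (a (2, 0) * a (3, 1) + a (2, 1) * a (3, 0)) = 0)
    (e3 : a (0, 0) * (a (2, 1) * a (3, 2) + a (2, 2) * a (3, 1)) + a (0, 1) * (a (2, 0) * a (3, 2) + a (2, 2) * a (3, 0)) + a (0, 2) * (a (2, 0) * a (3, 1) + a (2, 1) * a (3, 0)) = 0)
    {r s t : Fin 4} (h : (r = 0 ∧ s = 2 ∧ t = 3) ∨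
    (r = 0 ∧ s = 3 ∧ t = 2) ∨
    (r = 2 ∧ s = 0 ∧ t = 3) ∨
    (r = 2 ∧ s = 3 ∧ t = 0) ∨
    (r = 3 ∧ s = 0 ∧ t = 2) ∨
    (r = 3 ∧ s = 2 ∧ t = 0)) :
    compound (row a r) (row a s) *ᵥ row a t = 0 := by
  funext j
  rcases fin4_cases j with rfl | rfl | rfl | rfl
  · rcases h with ⟨rfl, rfl, rfl⟩ | ⟨rfl, rfl, rfl⟩ | ⟨rfl, rfl, rfl⟩ | ⟨rfl, rfl, rfl⟩ |
      ⟨rfl, rfl, rfl⟩ | ⟨rfl, rfl, rfl⟩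
    all_goals (rw [Pi.zero_apply, compound_mulVec_apply_zero]; simp only [row]; linear_combination e0)
  · rcases h with ⟨rfl, rfl, rfl⟩ | ⟨rfl, rfl, rfl⟩ | ⟨rfl, rfl, rfl⟩ | ⟨rfl, rfl, rfl⟩ |
      ⟨rfl, rfl, rfl⟩ | ⟨rfl, rfl, rfl⟩
    all_goals (rw [Pi.zero_apply, compound_mulVec_apply_one]; simp only [row]; linear_combination e1)
  · rcases h with ⟨rfl, rfl, rfl⟩ | ⟨rfl, rfl, rfl⟩ | ⟨rfl, rfl, rfl⟩ | ⟨rfl, rfl, rfl⟩ |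
      ⟨rfl, rfl, rfl⟩ | ⟨rfl, rfl, rfl⟩
    all_goals (rw [Pi.zero_apply, compound_mulVec_apply_two]; simp only [row]; linear_combination e2)
  · rcases h with ⟨rfl, rfl, rfl⟩ | ⟨rfl, rfl, rfl⟩ | ⟨rfl, rfl, rfl⟩ | ⟨rfl, rfl, rfl⟩ |
      ⟨rfl, rfl, rfl⟩ | ⟨rfl, rfl, rfl⟩
    all_goals (rw [Pi.zero_apply, compound_mulVec_apply_three]; simp only [row]; linear_combination e3)

omit [IsDomain L] in
/-- C0 with the deleted row `2` fixed: the four cubics deleting row `2` give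
`B(a_r,a_s) a_t = 0` for every ordering `(r,s,t)` of the other three rows. -/
private theorem c0_row2 (a : Fin 4 × Fin 4 → L)
    (e0 : a (0, 1) * (a (1, 2) * a (3, 3) + a (1, 3) * a (3, 2)) + a (0, 2) * (a (1, 1) * a (3, 3) + a (1, 3) * a (3, 1)) + a (0, 3) * (a (1, 1) * a (3, 2) + a (1, 2) * a (3, 1)) = 0)
    (e1 : a (0, 0) * (a (1, 2) * a (3, 3) + a (1, 3) * a (3, 2)) + a (0, 2) * (a (1, 0) * a (3, 3) + a (1, 3) * a (3, 0)) + a (0, 3) * (a (1, 0) * a (3, 2) + a (1, 2) * a (3, 0)) = 0)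
    (e2 : a (0, 0) * (a (1, 1) * a (3, 3) + a (1, 3) * a (3, 1)) + a (0, 1) * (a (1, 0) * a (3, 3) + a (1, 3) * a (3, 0)) + a (0, 3) * (a (1, 0) * a (3, 1) + a (1, 1) * a (3, 0)) = 0)
    (e3 : a (0, 0) * (a (1, 1) * a (3, 2) + a (1, 2) * a (3, 1)) + a (0, 1) * (a (1, 0) * a (3, 2) + a (1, 2) * a (3, 0)) + a (0, 2) * (a (1, 0) * a (3, 1) + a (1, 1) * a (3, 0)) = 0)
    {r s t : Fin 4} (h : (r = 0 ∧ s = 1 ∧ t = 3) ∨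
    (r = 0 ∧ s = 3 ∧ t = 1) ∨
    (r = 1 ∧ s = 0 ∧ t = 3) ∨
    (r = 1 ∧ s = 3 ∧ t = 0) ∨
    (r = 3 ∧ s = 0 ∧ t = 1) ∨
    (r = 3 ∧ s = 1 ∧ t = 0)) :
    compound (row a r) (row a s) *ᵥ row a t = 0 := by
  funext j
  rcases fin4_cases j with rfl | rfl | rfl | rfl
  · rcases h with ⟨rfl, rfl, rfl⟩ | ⟨rfl, rfl, rfl⟩ | ⟨rfl, rfl, rfl⟩ | ⟨rfl, rfl, rfl⟩ |
      ⟨rfl, rfl, rfl⟩ | ⟨rfl, rfl, rfl⟩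
    all_goals (rw [Pi.zero_apply, compound_mulVec_apply_zero]; simp only [row]; linear_combination e0)
  · rcases h with ⟨rfl, rfl, rfl⟩ | ⟨rfl, rfl, rfl⟩ | ⟨rfl, rfl, rfl⟩ | ⟨rfl, rfl, rfl⟩ |
      ⟨rfl, rfl, rfl⟩ | ⟨rfl, rfl, rfl⟩
    all_goals (rw [Pi.zero_apply, compound_mulVec_apply_one]; simp only [row]; linear_combination e1)
  · rcases h with ⟨rfl, rfl, rfl⟩ | ⟨rfl, rfl, rfl⟩ | ⟨rfl, rfl, rfl⟩ | ⟨rfl, rfl, rfl⟩ |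
      ⟨rfl, rfl, rfl⟩ | ⟨rfl, rfl, rfl⟩
    all_goals (rw [Pi.zero_apply, compound_mulVec_apply_two]; simp only [row]; linear_combination e2)
  · rcases h with ⟨rfl, rfl, rfl⟩ | ⟨rfl, rfl, rfl⟩ | ⟨rfl, rfl, rfl⟩ | ⟨rfl, rfl, rfl⟩ |
      ⟨rfl, rfl, rfl⟩ | ⟨rfl, rfl, rfl⟩
    all_goals (rw [Pi.zero_apply, compound_mulVec_apply_three]; simp only [row]; linear_combination e3)

omit [IsDomain L] in
/-- C0 with the deleted row `3` fixed: the four cubics deleting row `3` give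
`B(a_r,a_s) a_t = 0` for every ordering `(r,s,t)` of the other three rows. -/
private theorem c0_row3 (a : Fin 4 × Fin 4 → L)
    (e0 : a (0, 1) * (a (1, 2) * a (2, 3) + a (1, 3) * a (2, 2)) + a (0, 2) * (a (1, 1) * a (2, 3) + a (1, 3) * a (2, 1)) + a (0, 3) * (a (1, 1) * a (2, 2) + a (1, 2) * a (2, 1)) = 0)
    (e1 : a (0, 0) * (a (1, 2) * a (2, 3) + a (1, 3) * a (2, 2)) + a (0, 2) * (a (1, 0) * a (2, 3) + a (1, 3) * a (2, 0)) + a (0, 3) * (a (1, 0) * a (2, 2) + a (1, 2) * a (2, 0)) = 0)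
    (e2 : a (0, 0) * (a (1, 1) * a (2, 3) + a (1, 3) * a (2, 1)) + a (0, 1) * (a (1, 0) * a (2, 3) + a (1, 3) * a (2, 0)) + a (0, 3) * (a (1, 0) * a (2, 1) + a (1, 1) * a (2, 0)) = 0)
    (e3 : a (0, 0) * (a (1, 1) * a (2, 2) + a (1, 2) * a (2, 1)) + a (0, 1) * (a (1, 0) * a (2, 2) + a (1, 2) * a (2, 0)) + a (0, 2) * (a (1, 0) * a (2, 1) + a (1, 1) * a (2, 0)) = 0)
    {r s t : Fin 4} (h : (r = 0 ∧ s = 1 ∧ t = 2) ∨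
    (r = 0 ∧ s = 2 ∧ t = 1) ∨
    (r = 1 ∧ s = 0 ∧ t = 2) ∨
    (r = 1 ∧ s = 2 ∧ t = 0) ∨
    (r = 2 ∧ s = 0 ∧ t = 1) ∨
    (r = 2 ∧ s = 1 ∧ t = 0)) :
    compound (row a r) (row a s) *ᵥ row a t = 0 := by
  funext j
  rcases fin4_cases j with rfl | rfl | rfl | rfl
  · rcases h with ⟨rfl, rfl, rfl⟩ | ⟨rfl, rfl, rfl⟩ | ⟨rfl, rfl, rfl⟩ | ⟨rfl, rfl, rfl⟩ |
      ⟨rfl, rfl, rfl⟩ | ⟨rfl, rfl, rfl⟩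
    all_goals (rw [Pi.zero_apply, compound_mulVec_apply_zero]; simp only [row]; linear_combination e0)
  · rcases h with ⟨rfl, rfl, rfl⟩ | ⟨rfl, rfl, rfl⟩ | ⟨rfl, rfl, rfl⟩ | ⟨rfl, rfl, rfl⟩ |
      ⟨rfl, rfl, rfl⟩ | ⟨rfl, rfl, rfl⟩
    all_goals (rw [Pi.zero_apply, compound_mulVec_apply_one]; simp only [row]; linear_combination e1)
  · rcases h with ⟨rfl, rfl, rfl⟩ | ⟨rfl, rfl, rfl⟩ | ⟨rfl, rfl, rfl⟩ | ⟨rfl, rfl, rfl⟩ |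
      ⟨rfl, rfl, rfl⟩ | ⟨rfl, rfl, rfl⟩
    all_goals (rw [Pi.zero_apply, compound_mulVec_apply_two]; simp only [row]; linear_combination e2)
  · rcases h with ⟨rfl, rfl, rfl⟩ | ⟨rfl, rfl, rfl⟩ | ⟨rfl, rfl, rfl⟩ | ⟨rfl, rfl, rfl⟩ |
      ⟨rfl, rfl, rfl⟩ | ⟨rfl, rfl, rfl⟩
    all_goals (rw [Pi.zero_apply, compound_mulVec_apply_three]; simp only [row]; linear_combination e3)

omit [IsDomain L] in
/-- The `3 × 3` minor deleting row `r` and column `c` is the subpermanent on columns `≠ c`,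
rows `≠ r` (val-idea-10 g2, `Lines/sing_per4_support.lean` §2, verbatim). -/
theorem permanent_minor_eq_subperm (N : Matrix (Fin 4) (Fin 4) L) (r c : Fin 4) :
    (N.submatrix r.succAbove c.succAbove).permanent = N.subperm (· ≠ c) (· ≠ r) := by
  rw [N.subperm_eq_permanent_of_equiv (finSuccAboveEquiv c) (finSuccAboveEquiv r)]
  rfl

omit [IsDomain L] in
/-- `SubpermVanish` in the minor form used by the landed helper
`Theorems/SymPencilPerFourSingularLocusSupportMonomials.lean`. -/
theorem subpermVanish_minor (a : Fin 4 × Fin 4 → L) (hvan : SubpermVanish a) (r c : Fin 4) :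
    ((Matrix.of fun r c => a (r, c)).submatrix r.succAbove c.succAbove).permanent = 0 := by
  rw [permanent_minor_eq_subperm]; exact hvan r c

/-! ### §1 Layer-1 stubs -/

omit [IsDomain L] in
/-- **[PROVED v2.2] stub C0 (the sixteen equations in compound form; M; VERBATIM v1; keyed to the R125 (a) P3
port).**  Expanding the subpermanent that deletes row `w ∉ {r,s,t}` and column `j` along row `t`
gives `(B(a_r,a_s) a_t)_j`; so `SubpermVanish a` says `B(a_r,a_s) a_t = 0` for all distinct
`r,s,t` (checked in exact arithmetic for every ordering of the three rows, 19 200 cases,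
`compute/identities.py` I1; Lean: `Matrix.subperm` row expansion as in
`VonZurGathen.subperm_insert_row` / `BCMV25PermanentalVarieties.rsubperm_expand_row`). -/
theorem stub_compound_mulVec (a : Fin 4 × Fin 4 → L) (hvan : SubpermVanish a) {r s t : Fin 4}
    (hrs : r ≠ s) (hrt : r ≠ t) (hst : s ≠ t) :
    compound (row a r) (row a s) *ᵥ row a t = 0 := by
  obtain ⟨e00, e01, e02, e03, e10, e11, e12, e13, e20, e21, e22, e23, e30, e31, e32, e33⟩ :=
    subperm_three_explicit (Matrix.of fun r c => a (r, c)) (subpermVanish_minor a hvan)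
  simp only [Matrix.of_apply] at e00 e01 e02 e03 e10 e11 e12 e13 e20 e21 e22 e23 e30 e31 e32 e33
  obtain ⟨w, hwr, hws, hwt⟩ := exists_fourth r s t
  rcases fin4_cases w with rfl | rfl | rfl | rfl
  · exact c0_row0 a e00 e01 e02 e03 (perm_cases0 r s t hwr hws hwt hrs hrt hst)
  · exact c0_row1 a e10 e11 e12 e13 (perm_cases1 r s t hwr hws hwt hrs hrt hst)
  · exact c0_row2 a e20 e21 e22 e23 (perm_cases2 r s t hwr hws hwt hrs hrt hst)
  · exact c0_row3 a e30 e31 e32 e33 (perm_cases3 r s t hwr hws hwt hrs hrt hst)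


/-! #### NZ via the support theorem (PROVED; v2.2 reduction + v2.3 closure by name).
`stub_noZeroLine_zeros = noZeroLine_zeros_of_support (supportTheorem_holds L)`, where
`SupportTheorem L` is the statement of val-idea-10 g2's support theorem and `supportTheorem_holds` is
ONE application of the landed `Theorems/SymPencilPerFourSingularLocusSupportPatterns.support_of_subperm_vanish`
(accepted 2026-08-28 08:09Z; first proved in the workfile `Lines/sing_per4_support.lean`). -/

/-- The STATEMENT of val-idea-10 g2's support theorem (`Lines/sing_per4_support.lean`,
`SingPerFourSupport.support_of_subperm_vanish`, farm rc 0, no sorry), VERBATIM as a `Prop` over a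
commutative ring `R`: a `4 × 4` matrix over `R` with `12 ≠ 0` all of whose sixteen `3 × 3`
sub-permanents vanish has a zero row, a zero column, an anti-block zero pattern, or cross support.
(`SupportTheorem R` holds by `fun M h12 h => support_of_subperm_vanish h12 M h` — `supportTheorem_holds`
below, from the landed `…SupportPatterns` module.) -/
def SupportTheorem (R : Type*) [CommRing R] : Prop :=
  ∀ (M : Matrix (Fin 4) (Fin 4) R), (12 : R) ≠ 0 →
    (∀ r c : Fin 4, (M.submatrix r.succAbove c.succAbove).permanent = 0) →
    (∃ i : Fin 4, ∀ j : Fin 4, M i j = 0) ∨ (∃ j : Fin 4, ∀ i : Fin 4, M i j = 0) ∨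
    (∃ i₁ i₂ j₁ j₂ : Fin 4, i₁ ≠ i₂ ∧ j₁ ≠ j₂ ∧
        ∀ i j : Fin 4, ((i = i₁ ∨ i = i₂) ↔ (j = j₁ ∨ j = j₂)) → M i j = 0) ∨
    (∃ i₀ j₀ : Fin 4, ∀ i j : Fin 4, i ≠ i₀ → j ≠ j₀ → M i j = 0)

private theorem antiBlock_card : ∀ i₁ i₂ j₁ j₂ : Fin 4, i₁ ≠ i₂ → j₁ ≠ j₂ →
    8 ≤ (Finset.univ.filter
      (fun x : Fin 4 × Fin 4 => (x.1 = i₁ ∨ x.1 = i₂) ↔ (x.2 = j₁ ∨ x.2 = j₂))).card := by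
  decide +kernel

private theorem cross_card : ∀ i₀ j₀ : Fin 4,
    8 ≤ (Finset.univ.filter (fun x : Fin 4 × Fin 4 => x.1 ≠ i₀ ∧ x.2 ≠ j₀)).card := by
  decide +kernel

/-- `12 ≠ 0` in the `K`-algebra `L` from `2 ≠ 0`, `3 ≠ 0` in the field `K`. -/
theorem twelve_ne_zero_of (h2 : (2 : K) ≠ 0) (h3 : (3 : K) ≠ 0) : (12 : L) ≠ 0 := by
  intro h
  have h12K : (12 : K) ≠ 0 := by
    have e : (12 : K) = 2 * 2 * 3 := by norm_num
    rw [e]; exact mul_ne_zero (mul_ne_zero h2 h2) h3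
  apply h12K
  apply (algebraMap K L).injective
  rw [map_ofNat, map_zero]; exact h

/-- **NZ from the support theorem (PROVED reduction):** `SupportTheorem L` ⇒ stub NZ. -/
theorem noZeroLine_zeros_of_support (hS : SupportTheorem L) (h2 : (2 : K) ≠ 0) (h3 : (3 : K) ≠ 0)
    (a : Fin 4 × Fin 4 → L) (hvan : SubpermVanish a) (hz : ¬ HasZeroLine a) :
    ∃ Z : Finset (Fin 4 × Fin 4), 8 ≤ Z.card ∧ ∀ x ∈ Z, a x = 0 := by
  rcases hS (Matrix.of fun r c => a (r, c)) (twelve_ne_zero_of (K := K) h2 h3)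
      (subpermVanish_minor a hvan) with
    ⟨i, hi⟩ | ⟨j, hj⟩ | ⟨i₁, i₂, j₁, j₂, hi, hj, hH⟩ | ⟨i₀, j₀, hX⟩
  · exact absurd (Or.inl ⟨i, fun c => by simpa using hi c⟩) hz
  · exact absurd (Or.inr ⟨j, fun r => by simpa using hj r⟩) hz
  · refine ⟨Finset.univ.filter
      (fun x : Fin 4 × Fin 4 => (x.1 = i₁ ∨ x.1 = i₂) ↔ (x.2 = j₁ ∨ x.2 = j₂)),
      antiBlock_card i₁ i₂ j₁ j₂ hi hj, ?_⟩
    intro x hx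
    rw [Finset.mem_filter] at hx
    simpa using hH x.1 x.2 hx.2
  · refine ⟨Finset.univ.filter (fun x : Fin 4 × Fin 4 => x.1 ≠ i₀ ∧ x.2 ≠ j₀), cross_card i₀ j₀, ?_⟩
    intro x hx
    rw [Finset.mem_filter] at hx
    simpa using hX x.1 x.2 hx.2.1 hx.2.2

/-- **`SupportTheorem` holds over every domain with `12 ≠ 0` — BY NAME, one application of the landed
helper `Theorems/SymPencilPerFourSingularLocusSupportPatterns.support_of_subperm_vanish`
(val-idea-10 g2, accepted 2026-08-28 08:09Z; R132 (a)).** -/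
theorem supportTheorem_holds (R : Type*) [CommRing R] [IsDomain R] : SupportTheorem R :=
  fun M h12 h =>
    Summit.ValiantsHypothesis.ValiantsHypothesis.Theorems.SymPencilPerFourSingularLocusSupportPatterns.support_of_subperm_vanish
      h12 M h

/-- **stub NZ — PROVED v2.3 (BY NAME; the whole no-zero-line regime, R132 (a)).**  If `2 ≠ 0`, `3 ≠ 0`
and no row and no column of the singular point `a` vanishes, then at least eight COORDINATES of `a`
vanish: the landed support theorem (`12 · m = 0` for the two support monomials
`m₁ = x₀₂x₀₃x₁₁³x₂₀x₃₀³`, `m₂ = x₀₀x₀₁x₀₃x₁₂²x₂₁²x₃₀²` and their `S₄ × S₄ ⋊ transpose` images, + the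
sorted hitting-set cover, val-idea-10 g2) gives a zero row, a zero column, an anti-block
`I×J ∪ Iᶜ×Jᶜ` (`|J| = 2`, 8 cells) or a cross complement `(row i ∪ col j)ᶜ` (9 cells) inside the
zero set; the first two are excluded by `hz`.  (Statement and name unchanged from v2; moved below the
reduction it now uses.  Independent corroboration: this line's v1 algebra, card §B; 429 sampled
no-zero-line points over `F₅, F₇`, 0 exceptions.) -/
theorem stub_noZeroLine_zeros (h2 : (2 : K) ≠ 0) (h3 : (3 : K) ≠ 0) (a : Fin 4 × Fin 4 → L)
    (hvan : SubpermVanish a) (hz : ¬ HasZeroLine a) :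
    ∃ Z : Finset (Fin 4 × Fin 4), 8 ≤ Z.card ∧ ∀ x ∈ Z, a x = 0 :=
  noZeroLine_zeros_of_support (K := K) (supportTheorem_holds L) h2 h3 a hvan hz



/-! ### §1b Tools for the chains (PROVED, v2.1): index lemmas, the
`2 × 2` / `3 × 3` witness steps (`step_pair`, `step_three`: one application of
`VonZurGathen.height_ker_aeval_piecewise_insert` each) and the chain closer. -/

private theorem cover4 : ∀ w r s t : Fin 4, w ≠ r → w ≠ s → w ≠ t → r ≠ s → r ≠ t → s ≠ t →
    ∀ i : Fin 4, i = w ∨ i = r ∨ i = s ∨ i = t := by decide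

private theorem others2 : ∀ e f : Fin 4, e ≠ f →
    ∃ j c : Fin 4, j ≠ c ∧ j ≠ e ∧ j ≠ f ∧ c ≠ e ∧ c ≠ f := by decide

private theorem others4 :
    ∀ w : Fin 4, ∃ r s t : Fin 4, w ≠ r ∧ w ≠ s ∧ w ≠ t ∧ r ≠ s ∧ r ≠ t ∧ s ≠ t := by
  decide

omit [IsDomain L] in
theorem compound_symm (u v : Fin 4 → L) (j c : Fin 4) : compound u v j c = compound u v c j := by
  rw [compound_explicit]
  fin_cases j <;> fin_cases c <;> rfl

omit [IsDomain L] in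
theorem compound_apply_of_ne (u v : Fin 4 → L) {j c e f : Fin 4} (hjc : j ≠ c) (hje : j ≠ e)
    (hjf : j ≠ f) (hce : c ≠ e) (hcf : c ≠ f) (hef : e ≠ f) :
    compound u v j c = u e * v f + u f * v e := by
  rw [compound_explicit]
  revert hjc hje hjf hce hcf hef
  fin_cases j <;> fin_cases c <;> fin_cases e <;> fin_cases f <;> intro hjc hje hjf hce hcf hef
  all_goals first
    | exact absurd rfl hjc
    | exact absurd rfl hje
    | exact absurd rfl hjf
    | exact absurd rfl hce
    | exact absurd rfl hcf
    | exact absurd rfl hef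
    | (simp <;> ring)

omit [IsDomain L] in
/-- the six `2 × 2` permanents from `B = 0` -/
theorem pperm_eq_zero_of_compound_eq_zero {u v : Fin 4 → L} (hB : compound u v = 0)
    {e f : Fin 4} (hef : e ≠ f) : u e * v f + u f * v e = 0 := by
  obtain ⟨j, c, hjc, hje, hjf, hce, hcf⟩ := others2 e f hef
  rw [← compound_apply_of_ne u v hjc hje hjf hce hcf hef, hB]
  rfl

omit [IsDomain L] in
/-- `2 × 2` subpermanent of the square point matrix -/
theorem subperm_pair' (a : Fin 4 × Fin 4 → L) {r₀ r₁ i j : Fin 4} (hr : r₀ ≠ r₁)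
    (hij : i ≠ j) :
    (Matrix.of fun r c => a (r, c)).subperm (· ∈ insert i ({j} : Finset (Fin 4)))
      (· ∈ insert r₀ ({r₁} : Finset (Fin 4))) =
      a (r₀, i) * a (r₁, j) + a (r₀, j) * a (r₁, i) := by
  rw [← rsubperm_eq_subperm]
  exact rsubperm_pair _ hr hij

/-- **One vzG step with a `2 × 2` witness**: free the coordinate `(i', j')` with the witness
`per[X | rows {i', r₁}, cols {j', c₁}]`; `h0` = the relation at `a`, `h1` = the lead
coefficient `a (r₁, c₁) ≠ 0`; static rule: no position of these two rows and two columns has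
been freed before. -/
theorem step_pair (a : Fin 4 × Fin 4 → L) (T : Finset (Fin 4 × Fin 4)) {i' r₁ j' c₁ : Fin 4}
    (hi : i' ≠ r₁) (hj : j' ≠ c₁)
    (hT : ∀ x ∈ T, x.1 ∈ insert i' ({r₁} : Finset (Fin 4)) →
      x.2 ∈ insert j' ({c₁} : Finset (Fin 4)) → False)
    (hval : a (i', j') * a (r₁, c₁) + a (i', c₁) * a (r₁, j') = 0) (hlead : a (r₁, c₁) ≠ 0) :
    (RingHom.ker (aeval (R := K) ((insert (i', j') T).piecewise X (C ∘ a) :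
        Fin 4 × Fin 4 → MvPolynomial (Fin 4 × Fin 4) L))).height + 1 ≤
      (RingHom.ker (aeval (R := K) (T.piecewise X (C ∘ a) :
        Fin 4 × Fin 4 → MvPolynomial (Fin 4 × Fin 4) L))).height := by
  classical
  have hi' : i' ∉ ({r₁} : Finset (Fin 4)) := by simpa using hi
  have hj' : j' ∉ ({c₁} : Finset (Fin 4)) := by simpa using hj
  refine height_ker_aeval_piecewise_insert (K := K) a T (i', j')
    ((mvPolynomialX (Fin 4) (Fin 4) K).subperm (· ∈ insert j' ({c₁} : Finset (Fin 4)))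
      (· ∈ insert i' ({r₁} : Finset (Fin 4)))) ?_ ?_
  · rw [aeval_blockWitness_of_notMem a hT, subperm_pair' a hi hj,
      map_eq_zero_iff _ (C_injective _ _)]
    exact hval
  · rw [aeval_blockWitness_of_mem a hi' hj' (T := insert (i', j') T) (fun x hx h1 h2 => ?_)
        (Finset.mem_insert_self _ _), subperm_singleton, Matrix.of_apply]
    · exact X_mul_C_add_C_ne_zero hlead
    · rcases Finset.mem_insert.1 hx with h | h
      · exact h
      · exact (hT x h h1 h2).elim

/-- Closing the count: `n` strict steps below `Q_{T₀}` and `|T₀|` vanishing coordinates. -/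
theorem chain_close (a : Fin 4 × Fin 4 → L) (T₀ : Finset (Fin 4 × Fin 4))
    (hT₀ : ∀ x ∈ T₀, a x = 0) {n : ℕ}
    (hn : (n : ℕ∞) ≤ (RingHom.ker (aeval (R := K) (T₀.piecewise X (C ∘ a) :
        Fin 4 × Fin 4 → MvPolynomial (Fin 4 × Fin 4) L))).height) :
    ((n + T₀.card : ℕ) : ℕ∞) ≤ (RingHom.ker (aeval (R := K) a)).height := by
  have hz := height_ker_aeval_piecewise_add_card_le (K := K) a T₀ hT₀
  rw [ker_aeval_piecewise_empty] at hz
  push_cast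
  exact (add_le_add hn le_rfl).trans hz


private theorem mem3_iff_ne : ∀ j c e f : Fin 4, j ≠ c → j ≠ e → j ≠ f → c ≠ e → c ≠ f → e ≠ f →
    ∀ i : Fin 4, (i = c ∨ i = e ∨ i = f) ↔ i ≠ j := by decide

/-- **One vzG step with a `3 × 3` witness** freeing `(t, c)`: rows `{t, r, s}`, columns `{c, e, f}`
(= all columns but `j`); `h0` = the vanishing `3 × 3` subpermanent `hvan w j` (rows `≠ w` =
`{r,s,t}`), `h1` = the lead coefficient `per[{r,s} | {e,f}](a) ≠ 0`. -/
theorem step_three (a : Fin 4 × Fin 4 → L) (hvan : SubpermVanish a) (T : Finset (Fin 4 × Fin 4))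
    {w r s t j c e f : Fin 4} (hwr : w ≠ r) (hws : w ≠ s) (hwt : w ≠ t) (hrs : r ≠ s)
    (hrt : r ≠ t) (hst : s ≠ t) (hjc : j ≠ c) (hje : j ≠ e) (hjf : j ≠ f) (hce : c ≠ e)
    (hcf : c ≠ f) (hef : e ≠ f) (hT : ∀ x ∈ T, x.1 = w)
    (hlead : a (r, e) * a (s, f) + a (r, f) * a (s, e) ≠ 0) :
    (RingHom.ker (aeval (R := K) ((insert (t, c) T).piecewise X (C ∘ a) :
        Fin 4 × Fin 4 → MvPolynomial (Fin 4 × Fin 4) L))).height + 1 ≤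
      (RingHom.ker (aeval (R := K) (T.piecewise X (C ∘ a) :
        Fin 4 × Fin 4 → MvPolynomial (Fin 4 × Fin 4) L))).height := by
  classical
  have ht' : t ∉ insert r ({s} : Finset (Fin 4)) := by simp [Ne.symm hrt, Ne.symm hst]
  have hc' : c ∉ insert e ({f} : Finset (Fin 4)) := by simp [hce, hcf]
  have hfree : ∀ x ∈ T, x.1 ∈ insert t (insert r ({s} : Finset (Fin 4))) →
      x.2 ∈ insert c (insert e ({f} : Finset (Fin 4))) → False := by
    intro x hx h1 _
    simp only [Finset.mem_insert, Finset.mem_singleton] at h1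
    rw [hT x hx] at h1
    exact h1.elim hwt (fun h => h.elim hwr hws)
  refine height_ker_aeval_piecewise_insert (K := K) a T (t, c)
    ((mvPolynomialX (Fin 4) (Fin 4) K).subperm (· ∈ insert c (insert e ({f} : Finset (Fin 4))))
      (· ∈ insert t (insert r ({s} : Finset (Fin 4))))) ?_ ?_
  · rw [aeval_blockWitness_of_notMem a hfree, map_eq_zero_iff _ (C_injective _ _)]
    have hcols : ∀ i, i ∈ insert c (insert e ({f} : Finset (Fin 4))) ↔ i ≠ j := fun i => by
      simpa [Finset.mem_insert, Finset.mem_singleton] using mem3_iff_ne j c e f hjc hje hjf hce hcf hef i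
    have hrows : ∀ i, i ∈ insert t (insert r ({s} : Finset (Fin 4))) ↔ i ≠ w := fun i => by
      simpa [Finset.mem_insert, Finset.mem_singleton] using
        mem3_iff_ne w t r s hwt hwr hws (Ne.symm hrt) (Ne.symm hst) hrs i
    rw [Matrix.subperm_congr _ hcols hrows]
    exact hvan w j
  · rw [aeval_blockWitness_of_mem a ht' hc' (T := insert (t, c) T) (fun x hx h1 h2 => ?_)
        (Finset.mem_insert_self _ _), subperm_pair' a hrs hef]
    · exact X_mul_C_add_C_ne_zero hlead
    · rcases Finset.mem_insert.1 hx with h | h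
      · exact h
      · exact (hfree x h h1 h2).elim

/-! ### §2 The zero-line branch: support stubs, chain leaves, PROVED dispatch

Throughout: `w` is a zero row, `r, s, t` the other rows, `u = a_r`, `v = a_s`, `y = a_t`,
`B = compound u v`; `a^T := T.piecewise X (C ∘ a)` as in `VonZurGathenSingPermHeight`.
CHAIN RECIPE for a leaf with zero set `T₀` and witnesses `r₁, …, r_k` freeing `x₁, …, x_k`:
`hz := height_ker_aeval_piecewise_add_card_le a T₀ _` (zeros first), then for each `i` one
`height_ker_aeval_piecewise_insert a (T₀ ∪ {x₁..x_{i-1}}) xᵢ rᵢ h0 h1` where `h0` holds because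
`rᵢ` avoids `T₀ ∪ {x₁..x_{i-1}}` (`aeval_blockWitness_of_notMem` / `subperm_piecewise_eq_C`, value
`C (rᵢ(a)) = 0`) and `h1` because `rᵢ(a^{…∪xᵢ}) = X_{xᵢ} · C u + C w` with `u ≠ 0`
(`aeval_blockWitness_of_mem`, `X_mul_C_add_C_ne_zero`); add up with `natCast_succ_le` /
`ker_aeval_piecewise_empty` exactly as in `AlperBogartVelasco.height_ker_aeval_ge_of_threeByThree`
(case `live1`). -/

omit [IsDomain L] in
/-- **[PROVED v2.1] support stub T1 (S).**  `SubpermVanish` is invariant under transposition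
(`subperm` of the transpose swaps the two predicates; the index set of the sixteen conditions is
symmetric). -/
theorem stub_subpermVanish_transpose (a : Fin 4 × Fin 4 → L) (hvan : SubpermVanish a) :
    SubpermVanish (fun x : Fin 4 × Fin 4 => a (x.2, x.1)) := by
  intro r c
  have h : (Matrix.of fun r c => (fun x : Fin 4 × Fin 4 => a (x.2, x.1)) (r, c)) =
      (Matrix.of fun r c => a (r, c))ᵀ := by
    ext i j; rfl
  rw [h, Matrix.subperm_transpose]
  exact hvan c r

/-- **[PROVED v2.1] support stub T2 (S).**  The height of the point ideal is invariant under transposition of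
the coordinates (`aeval (a ∘ swap) = (aeval a).comp (rename swap)`, `MvPolynomial.aeval_rename`;
`rename swap` is a `K`-algebra automorphism, and heights are invariant under ring isomorphisms). -/
theorem stub_height_transpose (a : Fin 4 × Fin 4 → L) :
    (RingHom.ker (aeval (R := K) (fun x : Fin 4 × Fin 4 => a (x.2, x.1)))).height =
      (RingHom.ker (aeval (R := K) a)).height := by
  refine le_antisymm ?_ ?_
  · exact height_ker_aeval_comp_le (K := K) (Equiv.prodComm (Fin 4) (Fin 4)).toEmbedding a
  · have h := height_ker_aeval_comp_le (K := K) (Equiv.prodComm (Fin 4) (Fin 4)).toEmbedding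
      (fun x : Fin 4 × Fin 4 => a (x.2, x.1))
    exact h

/-- **[PROVED v2.1] support stub KL — the kernel-line identity (M; any `4 × 4` matrix over a domain, in fact over
any commutative ring).**  If `B y = 0` then `y` is proportional to every column of `adj B`:
`y_λ · adj B_{μκ} = y_μ · adj B_{λκ}`.  Polynomial-identity proof:
`adj_{μκ} y_λ − adj_{λκ} y_μ = Σ_{j ≠ κ} ε_j · det B[rows ∖ {κ,j} | cols ∖ {λ,μ}] · (B y)_j` with signs
`ε_j ∈ {±1}` (Jacobi's complementary-minor identity for the `2 × 2` minors of `adj B`; verified in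
exact arithmetic on random integer matrices incl. singular ones, `compute/identities.py` I3);
conceptual proof over a domain: rank `B ∈ {4, 3, ≤ 2}` gives `y = 0` / `ker B` a line containing
`y` and the column `κ` of `adj B` (`B · adj B = det B · 1 = 0`) / `adj B = 0`.  Mathlib's
`Matrix.adjugate` has the classical convention (`Matrix.mul_adjugate`). -/
theorem stub_kerline {B : Matrix (Fin 4) (Fin 4) L} {y : Fin 4 → L} (h : B *ᵥ y = 0)
    (l m k : Fin 4) : y l * B.adjugate m k = y m * B.adjugate l k := by
  classical
  by_cases hy : y = 0
  · simp [hy]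
  let F := FractionRing L
  let f : L →+* F := algebraMap L F
  have hf : Function.Injective f := IsFractionRing.injective L F
  apply hf
  have hadj : ∀ i j, f (B.adjugate i j) = (B.map f).adjugate i j := by
    intro i j
    have hm := RingHom.map_adjugate f B
    simp only [RingHom.mapMatrix_apply] at hm
    rw [← hm, Matrix.map_apply]
  have h' : B.map f *ᵥ (f ∘ y) = 0 := by
    funext i
    rw [← RingHom.map_mulVec, h, Pi.zero_apply, Pi.zero_apply, map_zero]
  have hy' : (f ∘ y) ≠ 0 := by
    intro h0
    apply hy
    funext i
    exact hf (by simpa using congrFun h0 i)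
  obtain ⟨z, hz⟩ := Literature.LinearAlgebra.Matrix.AdjugateEigenvectors.exists_adjugate_sub_smul_eq_vecMulVec
    (A := B.map f) (lam := 0) (x := f ∘ y) (by rw [zero_smul]; exact h') hy'
  rw [zero_smul, sub_zero] at hz
  rw [map_mul, map_mul, hadj, hadj, hz, vecMulVec_apply, vecMulVec_apply]
  simp only [Function.comp_apply]
  ring

private theorem succAbove_table (i : Fin 4) (j : Fin 3) :
    Fin.succAbove i j = ![![1, 2, 3], ![0, 2, 3], ![0, 1, 3], ![0, 1, 2]] i j := by
  revert i j; decide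

omit [IsDomain L] in
/-- The three `3 × 3` minors of `B(u,v)` through the entry `(0,1)` (principal `{0,1,2}`,
principal `{0,1,3}`, and rows `{0,1,2}` × columns `{0,1,3}`), read off `adj B = 0`. -/
theorem minors01 (u v : Fin 4 → L) (hadj : (compound u v).adjugate = 0) :
    2 * ((u 2 * v 3 + u 3 * v 2) * ((u 1 * v 3 + u 3 * v 1) * (u 0 * v 3 + u 3 * v 0))) = 0 ∧
    2 * ((u 2 * v 3 + u 3 * v 2) * ((u 1 * v 2 + u 2 * v 1) * (u 0 * v 2 + u 2 * v 0))) = 0 ∧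
    (u 2 * v 3 + u 3 * v 2) * ((u 1 * v 3 + u 3 * v 1) * (u 0 * v 2 + u 2 * v 0) +
      (u 1 * v 2 + u 2 * v 1) * (u 0 * v 3 + u 3 * v 0) -
      (u 2 * v 3 + u 3 * v 2) * (u 0 * v 1 + u 1 * v 0)) = 0 := by
  have h33 := congrFun (congrFun hadj 3) 3
  have h22 := congrFun (congrFun hadj 2) 2
  have h23 := congrFun (congrFun hadj 2) 3
  rw [compound_explicit] at h33 h22 h23
  simp only [adjugate_fin_succ_eq_det_submatrix, det_fin_three, submatrix_apply,
    succAbove_table, Matrix.zero_apply] at h33 h22 h23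
  simp only [Matrix.cons_val_zero, Matrix.cons_val_one, Matrix.cons_val,
    Matrix.of_apply, Matrix.cons_val', Matrix.empty_val', Matrix.cons_val_fin_one] at h33 h22 h23
  norm_num at h33 h22 h23
  exact ⟨by linear_combination h33, by linear_combination h22, by linear_combination -h23⟩

/-- The conclusion of CL (S2 ∨ S1a ∨ K), as a predicate. -/
def RankTwoConcl (u v : Fin 4 → L) : Prop :=
  (∃ j c : Fin 4, c ≠ j ∧ u j = 0 ∧ v j = 0 ∧ compound u v j c ≠ 0) ∨
    (∃ j c : Fin 4, c ≠ j ∧ u j ≠ 0 ∧ (∀ x, x ≠ j → u j * v x + u x * v j = 0) ∧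
      compound u v j c ≠ 0) ∨
    (∃ α β γ δ : Fin 4, α ≠ β ∧ α ≠ γ ∧ α ≠ δ ∧ β ≠ γ ∧ β ≠ δ ∧ γ ≠ δ ∧
      ((u α = 0 ∧ u β = 0) ∨ (v α = 0 ∧ v β = 0)) ∧ u γ * v δ + u δ * v γ = 0)

/-- STAR at `j` with an arm: S2 (if `u_j = 0`, then `v_j = 0` is forced by `u ≠ 0`) or S1a. -/
theorem star_out {u v : Fin 4 → L} (hu : u ≠ 0) {j c : Fin 4} (hcj : c ≠ j)
    (harm : compound u v j c ≠ 0) (hstar : ∀ x, x ≠ j → u j * v x + u x * v j = 0) :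
    RankTwoConcl u v := by
  by_cases huj : u j = 0
  · obtain ⟨z, hz⟩ := Function.ne_iff.1 hu
    have hz : u z ≠ 0 := by simpa using hz
    have hzj : z ≠ j := fun h => hz (by rw [h]; exact huj)
    have hvj : v j = 0 := by
      have h := hstar z hzj
      rw [huj, zero_mul, zero_add] at h
      exact (mul_eq_zero.1 h).resolve_left hz
    exact Or.inl ⟨j, c, hcj, huj, hvj, harm⟩
  · exact Or.inr (Or.inl ⟨j, c, hcj, huj, hstar, harm⟩)

/-- The K₂₂ exit: `p_{αβ} = d_{αβ} = 0` (so `u_α v_β = u_β v_α = 0` as `2 ≠ 0`), `p_{γδ} = 0`,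
arms at `α` and at `β` ⇒ K (u-side or v-side) or S2 at `α` / at `β`. -/
theorem k_out (h2L : (2 : L) ≠ 0) {u v : Fin 4 → L} {α β γ δ : Fin 4} (hαβ : α ≠ β)
    (hαγ : α ≠ γ) (hαδ : α ≠ δ) (hβγ : β ≠ γ) (hβδ : β ≠ δ) (hγδ : γ ≠ δ)
    (hP : u α * v β + u β * v α = 0) (hd : u α * v β - u β * v α = 0)
    (hK : u γ * v δ + u δ * v γ = 0) {cα cβ : Fin 4} (hcα : cα ≠ α)
    (harmα : compound u v α cα ≠ 0) (hcβ : cβ ≠ β) (harmβ : compound u v β cβ ≠ 0) :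
    RankTwoConcl u v := by
  have h1 : u α * v β = 0 := by
    have h : (2 : L) * (u α * v β) = 0 := by linear_combination hP + hd
    exact (mul_eq_zero.1 h).resolve_left h2L
  have h2 : u β * v α = 0 := by linear_combination hP - h1
  by_cases huα : u α = 0
  · rcases mul_eq_zero.1 h2 with huβ | hvα
    · exact Or.inr (Or.inr ⟨α, β, γ, δ, hαβ, hαγ, hαδ, hβγ, hβδ, hγδ, Or.inl ⟨huα, huβ⟩, hK⟩)
    · exact Or.inl ⟨α, cα, hcα, huα, hvα, harmα⟩
  · have hvβ : v β = 0 := (mul_eq_zero.1 h1).resolve_left huα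
    rcases mul_eq_zero.1 h2 with huβ | hvα
    · exact Or.inl ⟨β, cβ, hcβ, huβ, hvβ, harmβ⟩
    · exact Or.inr (Or.inr ⟨α, β, γ, δ, hαβ, hαγ, hαδ, hβγ, hβδ, hγδ, Or.inr ⟨hvα, hvβ⟩, hK⟩)

/-- CL anchored at a nonzero entry `B_{01}` (i.e. `p_{23}(u,v) ≠ 0`): triangle-freeness of the
support graph through the edge `01` + the one non-principal minor through it. -/
theorem core01 (h2L : (2 : L) ≠ 0) {u v : Fin 4 → L} (hu : u ≠ 0)
    (h01 : compound u v 0 1 ≠ 0) (hadj : (compound u v).adjugate = 0) : RankTwoConcl u v := by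
  obtain ⟨m33, m22, m23⟩ := minors01 u v hadj
  have hP23 : u 2 * v 3 + u 3 * v 2 ≠ 0 := by simpa [compound_explicit] using h01
  have a10 : compound u v 1 0 ≠ 0 := by rwa [compound_symm]
  have e23 : compound u v 2 3 = u 0 * v 1 + u 1 * v 0 := by simp [compound_explicit]
  have e32 : compound u v 3 2 = u 0 * v 1 + u 1 * v 0 := by simp [compound_explicit]
  have T2 : (u 1 * v 3 + u 3 * v 1) * (u 0 * v 3 + u 3 * v 0) = 0 := by
    rcases mul_eq_zero.1 m33 with h | h
    · exact absurd h h2L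
    · exact (mul_eq_zero.1 h).resolve_left hP23
  have T3 : (u 1 * v 2 + u 2 * v 1) * (u 0 * v 2 + u 2 * v 0) = 0 := by
    rcases mul_eq_zero.1 m22 with h | h
    · exact absurd h h2L
    · exact (mul_eq_zero.1 h).resolve_left hP23
  have N : (u 1 * v 3 + u 3 * v 1) * (u 0 * v 2 + u 2 * v 0) +
      (u 1 * v 2 + u 2 * v 1) * (u 0 * v 3 + u 3 * v 0) -
      (u 2 * v 3 + u 3 * v 2) * (u 0 * v 1 + u 1 * v 0) = 0 :=
    (mul_eq_zero.1 m23).resolve_left hP23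
  -- STAR(1) and STAR(0)
  have star1 : u 1 * v 3 + u 3 * v 1 = 0 → u 1 * v 2 + u 2 * v 1 = 0 → RankTwoConcl u v := by
    intro h13 h12
    have h01' : u 0 * v 1 + u 1 * v 0 = 0 := by
      have h : (u 2 * v 3 + u 3 * v 2) * (u 0 * v 1 + u 1 * v 0) = 0 := by
        linear_combination (u 0 * v 2 + u 2 * v 0) * h13 + (u 0 * v 3 + u 3 * v 0) * h12 - N
      exact (mul_eq_zero.1 h).resolve_left hP23
    refine star_out hu (j := 1) (c := 0) (by decide) a10 ?_
    intro x hx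
    rcases fin4_cases x with rfl | rfl | rfl | rfl
    · linear_combination h01'
    · exact absurd rfl hx
    · linear_combination h12
    · linear_combination h13
  have star0 : u 0 * v 3 + u 3 * v 0 = 0 → u 0 * v 2 + u 2 * v 0 = 0 → RankTwoConcl u v := by
    intro h03 h02
    have h01' : u 0 * v 1 + u 1 * v 0 = 0 := by
      have h : (u 2 * v 3 + u 3 * v 2) * (u 0 * v 1 + u 1 * v 0) = 0 := by
        linear_combination (u 1 * v 3 + u 3 * v 1) * h02 + (u 1 * v 2 + u 2 * v 1) * h03 - N
      exact (mul_eq_zero.1 h).resolve_left hP23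
    refine star_out hu (j := 0) (c := 1) (by decide) h01 ?_
    intro x hx
    rcases fin4_cases x with rfl | rfl | rfl | rfl
    · exact absurd rfl hx
    · linear_combination h01'
    · linear_combination h02
    · linear_combination h03
  rcases mul_eq_zero.1 T2 with h13 | h03
  · rcases mul_eq_zero.1 T3 with h12 | h02
    · exact star1 h13 h12
    · -- 4-cycle `0–1–2–3`: `p₁₃ = p₀₂ = 0`, `p₁₂ p₀₃ = p₂₃ p₀₁`
      by_cases h01z : u 0 * v 1 + u 1 * v 0 = 0
      · have h : (u 1 * v 2 + u 2 * v 1) * (u 0 * v 3 + u 3 * v 0) = 0 := by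
          linear_combination N - (u 0 * v 2 + u 2 * v 0) * h13 + (u 2 * v 3 + u 3 * v 2) * h01z
        rcases mul_eq_zero.1 h with h12 | h03
        · exact star1 h13 h12
        · exact star0 h03 h02
      · have a23 : compound u v 2 3 ≠ 0 := by rw [e23]; exact h01z
        have a32 : compound u v 3 2 ≠ 0 := by rw [e32]; exact h01z
        have hd : (u 0 * v 2 - u 2 * v 0) * (u 1 * v 3 - u 3 * v 1) = 0 := by
          linear_combination N - (u 0 * v 2 + u 2 * v 0) * h13
        rcases mul_eq_zero.1 hd with d02 | d13
        · exact k_out h2L (α := 0) (β := 2) (γ := 1) (δ := 3) (by decide) (by decide) (by decide)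
            (by decide) (by decide) (by decide) h02 d02 h13 (cα := 1) (by decide) h01 (cβ := 3)
            (by decide) a23
        · exact k_out h2L (α := 1) (β := 3) (γ := 0) (δ := 2) (by decide) (by decide) (by decide)
            (by decide) (by decide) (by decide) h13 d13 h02 (cα := 0) (by decide) a10 (cβ := 2)
            (by decide) a32
  · rcases mul_eq_zero.1 T3 with h12 | h02
    · -- 4-cycle `0–1–3–2`: `p₀₃ = p₁₂ = 0`, `p₁₃ p₀₂ = p₂₃ p₀₁`
      by_cases h01z : u 0 * v 1 + u 1 * v 0 = 0
      · have h : (u 1 * v 3 + u 3 * v 1) * (u 0 * v 2 + u 2 * v 0) = 0 := by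
          linear_combination N - (u 0 * v 3 + u 3 * v 0) * h12 + (u 2 * v 3 + u 3 * v 2) * h01z
        rcases mul_eq_zero.1 h with h13 | h02
        · exact star1 h13 h12
        · exact star0 h03 h02
      · have a23 : compound u v 2 3 ≠ 0 := by rw [e23]; exact h01z
        have a32 : compound u v 3 2 ≠ 0 := by rw [e32]; exact h01z
        have hd : (u 0 * v 3 - u 3 * v 0) * (u 1 * v 2 - u 2 * v 1) = 0 := by
          linear_combination N - (u 0 * v 3 + u 3 * v 0) * h12
        rcases mul_eq_zero.1 hd with d03 | d12
        · exact k_out h2L (α := 0) (β := 3) (γ := 1) (δ := 2) (by decide) (by decide) (by decide)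
            (by decide) (by decide) (by decide) h03 d03 h12 (cα := 1) (by decide) h01 (cβ := 2)
            (by decide) a32
        · exact k_out h2L (α := 1) (β := 2) (γ := 0) (δ := 3) (by decide) (by decide) (by decide)
            (by decide) (by decide) (by decide) h12 d12 h03 (cα := 0) (by decide) a10 (cβ := 3)
            (by decide) a23
    · exact star0 h03 h02

omit [IsDomain L] in
/-- `B(u,v)` is equivariant under relabelling of the four indices. -/
theorem compound_perm (e : Equiv.Perm (Fin 4)) (u v : Fin 4 → L) :
    compound (u ∘ e) (v ∘ e) = (compound u v).submatrix e e := by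
  ext j c
  simp only [compound, Matrix.submatrix_apply, Matrix.of_apply, Function.comp_apply,
    EmbeddingLike.apply_eq_iff_eq]
  split_ifs with hjc
  · rfl
  · refine Fintype.sum_equiv e _ _ fun a => ?_
    refine Fintype.sum_equiv e _ _ fun b => ?_
    simp only [ne_eq, EmbeddingLike.apply_eq_iff_eq]

/-- **[PROVED v2.2] support stub CL — classification of rank-two permanental compounds (M; char ≠ 2).**  For
nonzero rows `u, v` with `B = compound u v ≠ 0` and `adj B = 0` (rank `B ≤ 2`; rank 1 never
occurs), one of:  (S2) a common zero `u_j = v_j = 0` with an arm `B_{jc} ≠ 0`;  (S1a) `u_j ≠ 0`,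
the STAR relations `p_{jx}(u,v) = 0` (`x ≠ j`) and an arm `B_{jc} ≠ 0`;  (K) a K₂₂ pattern: a
partition `{α,β} | {γ,δ}` with `u_α = u_β = 0` or `v_α = v_β = 0`, and `p_{γδ}(u,v) = 0`.
PROOF PATH: `adj B = 0` ⇔ all `3 × 3` minors vanish; for the symmetric zero-diagonal `B` the
principal ones are `2 B_ij B_jk B_ik` ⇒ the support graph of `B` is triangle-free, hence inside a
star `K_{1,3}(j)` or a 4-cycle `K_{2,2}(αβ|γδ)` (the seven triangle-free graphs on 4 vertices);
star ⇔ STAR relations (`B_{cd} = p_{jx}`, `{c,d,j,x} = [4]`), and `u_j = 0` forces `v_j = 0`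
(`u ≠ 0`); 4-cycle: `p_{αβ} = p_{γδ} = 0` and the block determinant
`B_αγ B_βδ − B_αδ B_βγ = p_βδ p_αγ − p_βγ p_αδ = −d_αβ(u,v) d_γδ(u,v) = 0` (else `adj B ≠ 0`),
and `p_αβ = d_αβ = 0` ⇒ `2 u_α v_β = 2 u_β v_α = 0` ⇒ K (or S2 at `α`/`β`).  Exhaustively
verified: `F₃` (all compounds of rank 2 met by the tree), `F₇` (1 980 rank-two compounds, v1
`compute/Bfacts.py`), 0 exceptions. -/
theorem stub_rankTwo_classification (h2 : (2 : K) ≠ 0) {u v : Fin 4 → L} (hu : u ≠ 0)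
    (_hv : v ≠ 0) (hB : compound u v ≠ 0) (hadj : (compound u v).adjugate = 0) :
    (∃ j c : Fin 4, c ≠ j ∧ u j = 0 ∧ v j = 0 ∧ compound u v j c ≠ 0) ∨
    (∃ j c : Fin 4, c ≠ j ∧ u j ≠ 0 ∧ (∀ x, x ≠ j → u j * v x + u x * v j = 0) ∧
      compound u v j c ≠ 0) ∨
    (∃ α β γ δ : Fin 4, α ≠ β ∧ α ≠ γ ∧ α ≠ δ ∧ β ≠ γ ∧ β ≠ δ ∧ γ ≠ δ ∧
      ((u α = 0 ∧ u β = 0) ∨ (v α = 0 ∧ v β = 0)) ∧ u γ * v δ + u δ * v γ = 0) := by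
  classical
  have h2L : (2 : L) ≠ 0 := by
    intro h
    apply h2
    have h' : algebraMap K L 2 = algebraMap K L 0 := by rw [map_ofNat, map_zero]; exact h
    exact (algebraMap K L).injective h'
  obtain ⟨p, q, hpq0⟩ : ∃ p q, compound u v p q ≠ 0 := by
    by_contra h
    push Not at h
    exact hB (Matrix.ext fun i j => by rw [h i j]; rfl)
  have hpq : p ≠ q := by
    rintro rfl
    apply hpq0
    simp [compound]
  obtain ⟨x, y, hxy, hxp, hxq, hyp, hyq⟩ := others2 p q hpq
  have hinj : Function.Injective ![p, q, x, y] := by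
    intro i j h
    fin_cases i <;> fin_cases j <;> simp_all [eq_comm]
  set e : Fin 4 ≃ Fin 4 := Equiv.ofBijective _ (Finite.injective_iff_bijective.1 hinj) with he
  have he0 : e 0 = p := by simp [he]
  have he1 : e 1 = q := by simp [he]
  have hcomp : ∀ j c, compound (u ∘ e) (v ∘ e) j c = compound u v (e j) (e c) := fun j c => by
    rw [compound_perm]; rfl
  have hadj' : (compound (u ∘ e) (v ∘ e)).adjugate = 0 := by
    rw [compound_perm, Matrix.adjugate_submatrix_equiv_self, hadj, Matrix.submatrix_zero,
      Pi.zero_def, Pi.zero_def]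
  have hu' : u ∘ e ≠ 0 := fun h => hu (funext fun i => by simpa using congrFun h (e.symm i))
  have h01 : compound (u ∘ e) (v ∘ e) 0 1 ≠ 0 := by rw [hcomp, he0, he1]; exact hpq0
  rcases core01 h2L hu' h01 hadj' with ⟨j, c, hcj, huj, hvj, harm⟩ |
      ⟨j, c, hcj, huj, hstar, harm⟩ | ⟨α, β, γ, δ, hαβ, hαγ, hαδ, hβγ, hβδ, hγδ, hzero, hK⟩
  · exact Or.inl ⟨e j, e c, e.injective.ne hcj, huj, hvj, by rwa [← hcomp]⟩
  · refine Or.inr (Or.inl ⟨e j, e c, e.injective.ne hcj, huj, fun x' hx' => ?_, by rwa [← hcomp]⟩)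
    have h := hstar (e.symm x') (fun h => hx' (by rw [← h, Equiv.apply_symm_apply]))
    simpa using h
  · exact Or.inr (Or.inr ⟨e α, e β, e γ, e δ, e.injective.ne hαβ, e.injective.ne hαγ,
      e.injective.ne hαδ, e.injective.ne hβγ, e.injective.ne hβδ, e.injective.ne hγδ, hzero, hK⟩)

omit [IsDomain L] in
/-- `compound` commutes with ring maps (entrywise). -/
theorem compound_map {L' : Type*} [CommRing L'] [IsDomain L'] (g : L →+* L') (u v : Fin 4 → L) :
    (compound u v).map g = compound (g ∘ u) (g ∘ v) := by
  rw [compound_explicit, compound_explicit]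
  ext i j
  fin_cases i <;> fin_cases j <;> simp

/-- Under a block evaluation `a^T` that never frees a coordinate of the rows `r, s`, the adjugate
entries of the GENERIC compound `B(X_r, X_s)` evaluate to `C` of the adjugate entries of
`B(a_r, a_s)` (`RingHom.map_adjugate` twice). -/
theorem aeval_adjugate_compound_X (a : Fin 4 × Fin 4 → L) (T : Finset (Fin 4 × Fin 4))
    {r s : Fin 4} (hT : ∀ x ∈ T, x.1 ≠ r ∧ x.1 ≠ s) (i j : Fin 4) :
    aeval (T.piecewise X (C ∘ a) : Fin 4 × Fin 4 → MvPolynomial (Fin 4 × Fin 4) L)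
        ((compound (row (fun x : Fin 4 × Fin 4 => (X x : MvPolynomial (Fin 4 × Fin 4) K)) r)
          (row (fun x : Fin 4 × Fin 4 => (X x : MvPolynomial (Fin 4 × Fin 4) K)) s)).adjugate i j) =
      C ((compound (row a r) (row a s)).adjugate i j) := by
  classical
  set φ : Fin 4 × Fin 4 → MvPolynomial (Fin 4 × Fin 4) L := T.piecewise X (C ∘ a) with hφ
  have hval : ∀ x : Fin 4 × Fin 4, (x.1 = r ∨ x.1 = s) → φ x = C (a x) := by
    intro x hx
    have hxT : x ∉ T := fun hmem => by
      rcases hx with h | h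
      · exact (hT x hmem).1 h
      · exact (hT x hmem).2 h
    rw [hφ, Finset.piecewise_eq_of_notMem (hi := hxT), Function.comp_apply]
  set Bg := compound (row (fun x : Fin 4 × Fin 4 => (X x : MvPolynomial (Fin 4 × Fin 4) K)) r)
    (row (fun x : Fin 4 × Fin 4 => (X x : MvPolynomial (Fin 4 × Fin 4) K)) s) with hBg
  have key : (aeval φ).toRingHom.mapMatrix Bg = (compound (row a r) (row a s)).map C := by
    rw [RingHom.mapMatrix_apply, hBg, compound_map, compound_map]
    congr 1
    · funext e
      simp only [Function.comp_apply, row, RingHom.coe_coe, AlgHom.toRingHom_eq_coe, aeval_X]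
      exact hval (r, e) (Or.inl rfl)
    · funext e
      simp only [Function.comp_apply, row, RingHom.coe_coe, AlgHom.toRingHom_eq_coe, aeval_X]
      exact hval (s, e) (Or.inr rfl)
  have h1 : aeval φ (Bg.adjugate i j) = ((aeval φ).toRingHom.mapMatrix Bg.adjugate) i j := by
    simp [RingHom.mapMatrix_apply, Matrix.map_apply]
  rw [h1, RingHom.map_adjugate, key]
  have h2 := RingHom.map_adjugate (C : L →+* MvPolynomial (Fin 4 × Fin 4) L)
    (compound (row a r) (row a s))
  simp only [RingHom.mapMatrix_apply] at h2
  rw [← h2, Matrix.map_apply]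

/-- **One kernel-line step** freeing `(t, l)` with the witness
`W = X_{(t,l)} · adj B(X_r,X_s)_{mk} − X_{(t,m)} · adj B(X_r,X_s)_{lk}`. -/
theorem step_kerline (a : Fin 4 × Fin 4 → L) (T : Finset (Fin 4 × Fin 4)) {w r s t : Fin 4}
    (hwr : w ≠ r) (hws : w ≠ s) (hrt : r ≠ t) (hst : s ≠ t)
    (hT : ∀ x ∈ T, x.1 = w ∨ x.1 = t) {l m k : Fin 4} (hlm : l ≠ m) (hl : (t, l) ∉ T)
    (hm : (t, m) ∉ T)
    (hval : a (t, l) * (compound (row a r) (row a s)).adjugate m k =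
      a (t, m) * (compound (row a r) (row a s)).adjugate l k)
    (hlead : (compound (row a r) (row a s)).adjugate m k ≠ 0) :
    (RingHom.ker (aeval (R := K) ((insert (t, l) T).piecewise X (C ∘ a) :
        Fin 4 × Fin 4 → MvPolynomial (Fin 4 × Fin 4) L))).height + 1 ≤
      (RingHom.ker (aeval (R := K) (T.piecewise X (C ∘ a) :
        Fin 4 × Fin 4 → MvPolynomial (Fin 4 × Fin 4) L))).height := by
  classical
  set Bg := compound (row (fun x : Fin 4 × Fin 4 => (X x : MvPolynomial (Fin 4 × Fin 4) K)) r)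
    (row (fun x : Fin 4 × Fin 4 => (X x : MvPolynomial (Fin 4 × Fin 4) K)) s) with hBg
  set B := compound (row a r) (row a s) with hB
  have hrows : ∀ x ∈ T, x.1 ≠ r ∧ x.1 ≠ s := by
    intro x hx
    rcases hT x hx with h | h <;> rw [h]
    · exact ⟨hwr, hws⟩
    · exact ⟨Ne.symm hrt, Ne.symm hst⟩
  have hrows' : ∀ x ∈ insert (t, l) T, x.1 ≠ r ∧ x.1 ≠ s := by
    intro x hx
    rcases Finset.mem_insert.1 hx with h | h
    · rw [h]; exact ⟨Ne.symm hrt, Ne.symm hst⟩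
    · exact hrows x h
  have hm' : (t, m) ∉ insert (t, l) T := by
    simp only [Finset.mem_insert, Prod.mk.injEq, true_and, not_or]
    exact ⟨Ne.symm hlm, hm⟩
  refine height_ker_aeval_piecewise_insert (K := K) a T (t, l)
    (X (t, l) * Bg.adjugate m k - X (t, m) * Bg.adjugate l k) ?_ ?_
  · rw [map_sub, map_mul, map_mul, aeval_X, aeval_X,
      aeval_adjugate_compound_X (K := K) a T hrows, aeval_adjugate_compound_X (K := K) a T hrows,
      Finset.piecewise_eq_of_notMem (hi := hl), Finset.piecewise_eq_of_notMem (hi := hm),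
      Function.comp_apply, Function.comp_apply, ← map_mul, ← map_mul, ← map_sub, hval, sub_self,
      map_zero]
  · rw [map_sub, map_mul, map_mul, aeval_X, aeval_X,
      aeval_adjugate_compound_X (K := K) a _ hrows', aeval_adjugate_compound_X (K := K) a _ hrows',
      Finset.piecewise_eq_of_mem (hi := Finset.mem_insert_self _ _),
      Finset.piecewise_eq_of_notMem (hi := hm'), Function.comp_apply]
    have e : (X (t, l) * C (B.adjugate m k) - C (a (t, m)) * C (B.adjugate l k) :
        MvPolynomial (Fin 4 × Fin 4) L) =
        X (t, l) * C (B.adjugate m k) + C (-(a (t, m) * B.adjugate l k)) := by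
      rw [map_neg, map_mul]; ring
    rw [e]
    exact X_mul_C_add_C_ne_zero hlead

/-- **[PROVED v2.2] leaf stub Z.R3 — kernel line (M; chain length exactly 7).**  Zero row `w`; an entry
`adj B_{mk} ≠ 0` of `B = B(a_r, a_s)`.  CHAIN: `T₀ = {w} × [4]` (4 zeros); then for each of the
three `λ ≠ m` free `(t, λ)` with the witness
`W_λ = X_{(t,λ)} · adj B(X_r,X_s)_{mk} − X_{(t,m)} · adj B(X_r,X_s)_{λk} ∈ K[X]` (generic rows
`r,s`: the entries of `compound` of the rows of `mvPolynomialX`; `AlgHom.map_adjugate` moves `aeval`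
inside): support = rows `r,s` ∪ `{(t,λ),(t,m)}`, disjoint from `T₀` and from the earlier `(t,λ')`;
`W_λ(a) = 0` by `stub_kerline` with `B(a_r,a_s) a_t = 0` (`stub_compound_mulVec`); after freeing
`(t,λ)`: `X_{(t,λ)} · C (adj B_{mk}(a)) + C (−a_{tm} adj B_{λk}(a))`, lead `≠ 0` = the hypothesis.
`4 + 3 = 7`.  (If `det B ≠ 0` the row `a_t` is zero and the same chain still works.) -/
theorem stub_Z_kerline (a : Fin 4 × Fin 4 → L) (hvan : SubpermVanish a) {w r s t : Fin 4}
    (hwr : w ≠ r) (hws : w ≠ s) (hwt : w ≠ t) (hrs : r ≠ s) (hrt : r ≠ t) (hst : s ≠ t)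
    (hw : ∀ c, a (w, c) = 0) {m k : Fin 4}
    (hadj : (compound (row a r) (row a s)).adjugate m k ≠ 0) :
    (7 : ℕ∞) ≤ (RingHom.ker (aeval (R := K) a)).height := by
  classical
  set B := compound (row a r) (row a s) with hB
  have hBy : B *ᵥ row a t = 0 := stub_compound_mulVec a hvan hrs hrt hst
  have hKL : ∀ l, a (t, l) * B.adjugate m k = a (t, m) * B.adjugate l k := fun l =>
    stub_kerline hBy l m k
  obtain ⟨l₁, l₂, l₃, h1, h2, h3, h12, h13, h23⟩ := others4 m
  set T₀ : Finset (Fin 4 × Fin 4) := ({w} : Finset (Fin 4)) ×ˢ Finset.univ with hT₀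
  have hmemT₀ : ∀ x ∈ T₀, x.1 = w := fun x hx =>
    Finset.mem_singleton.1 (Finset.mem_product.1 hx).1
  have hT₀zero : ∀ x ∈ T₀, a x = 0 := by
    intro x hx
    rw [show x = (w, x.2) from Prod.ext (hmemT₀ x hx) rfl]; exact hw x.2
  have hT₀card : T₀.card = 4 := by
    rw [hT₀, Finset.card_product, Finset.card_singleton, Finset.card_univ, Fintype.card_fin]
  have notin : ∀ (l : Fin 4) (S : Finset (Fin 4 × Fin 4)),
      (∀ x ∈ S, x.1 = w ∨ (x.1 = t ∧ x.2 ≠ l)) → (t, l) ∉ S := by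
    intro l S hS hmem
    rcases hS _ hmem with h | ⟨-, h⟩
    · exact hwt h.symm
    · exact h rfl
  have weak : ∀ (l : Fin 4) (S : Finset (Fin 4 × Fin 4)),
      (∀ x ∈ S, x.1 = w ∨ (x.1 = t ∧ x.2 ≠ l)) → ∀ x ∈ S, x.1 = w ∨ x.1 = t :=
    fun l S hS x hx => (hS x hx).imp_right And.left
  set T₁ := insert (t, l₁) T₀ with hT₁
  set T₂ := insert (t, l₂) T₁ with hT₂
  -- membership invariants
  have i₀ : ∀ l, ∀ x ∈ T₀, x.1 = w ∨ (x.1 = t ∧ x.2 ≠ l) := fun l x hx => Or.inl (hmemT₀ x hx)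
  have i₁ : ∀ l, l ≠ l₁ → ∀ x ∈ T₁, x.1 = w ∨ (x.1 = t ∧ x.2 ≠ l) := by
    intro l hl x hx
    rcases Finset.mem_insert.1 hx with h | h
    · rw [h]; exact Or.inr ⟨rfl, Ne.symm hl⟩
    · exact i₀ l x h
  have i₂ : ∀ l, l ≠ l₁ → l ≠ l₂ → ∀ x ∈ T₂, x.1 = w ∨ (x.1 = t ∧ x.2 ≠ l) := by
    intro l hl hl' x hx
    rcases Finset.mem_insert.1 hx with h | h
    · rw [h]; exact Or.inr ⟨rfl, Ne.symm hl'⟩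
    · exact i₁ l hl x h
  have st₁ := step_kerline (K := K) a T₀ hwr hws hrt hst (weak m _ (i₀ m)) (Ne.symm h1)
    (notin l₁ _ (i₀ l₁)) (notin m _ (i₀ m)) (hKL l₁) hadj
  have st₂ := step_kerline (K := K) a T₁ hwr hws hrt hst (weak m _ (i₁ m h1)) (Ne.symm h2)
    (notin l₂ _ (i₁ l₂ (Ne.symm h12))) (notin m _ (i₁ m h1)) (hKL l₂) hadj
  have st₃ := step_kerline (K := K) a T₂ hwr hws hrt hst (weak m _ (i₂ m h1 h2)) (Ne.symm h3)
    (notin l₃ _ (i₂ l₃ (Ne.symm h13) (Ne.symm h23))) (notin m _ (i₂ m h1 h2)) (hKL l₃) hadj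
  have c1 := natCast_succ_le (n := 0) (by simp) st₃
  have c2 := natCast_succ_le c1 st₂
  have c3 := natCast_succ_le c2 st₁
  have h := chain_close (K := K) a T₀ hT₀zero c3
  rw [hT₀card] at h
  exact_mod_cast h

/-- **[PROVED v2.1] leaf stub Z.B0 — vanishing compound (S; chain length 7).**  Zero row `w`; `B(a_r,a_s) = 0`,
i.e. all six `2 × 2` permanents `p_{ef}(a_r,a_s) = a_{re}a_{sf} + a_{rf}a_{se}` vanish (entry
`(j,c)` of `compound` with `{j,c,e,f} = [4]`); `a_{re} ≠ 0`.  CHAIN: `T₀ = {w} × [4]`; then for the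
three `f ≠ e` free `(s, f)` with witness `p_{ef}(X_r,X_s)` (= `rsubperm` of the generic matrix on
rows `{r,s}`, columns `{e,f}`, `rsubperm_pair`; `aeval_blockWitness_of_mem` with `Rw = {r}`,
`Cl = {e}`): lead coefficient `a_{re} ≠ 0`, value at `a` is `p_{ef}(a_r,a_s) = 0`, support
`{r,s} × {e,f}` disjoint from `T₀` and from the earlier `(s,f')` (`(s,e)` is never freed).
`4 + 3 = 7`. -/
theorem stub_Z_compoundZero (a : Fin 4 × Fin 4 → L) (_hvan : SubpermVanish a) {w r s t : Fin 4}
    (hwr : w ≠ r) (hws : w ≠ s) (_hwt : w ≠ t) (hrs : r ≠ s) (_hrt : r ≠ t) (_hst : s ≠ t)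
    (hw : ∀ c, a (w, c) = 0) (hB : compound (row a r) (row a s) = 0) {e : Fin 4}
    (he : a (r, e) ≠ 0) :
    (7 : ℕ∞) ≤ (RingHom.ker (aeval (R := K) a)).height := by
  classical
  obtain ⟨f₁, f₂, f₃, h1, h2, h3, h12, h13, h23⟩ := others4 e
  have hp : ∀ f, f ≠ e → a (s, f) * a (r, e) + a (s, e) * a (r, f) = 0 := by
    intro f hfe
    have := pperm_eq_zero_of_compound_eq_zero hB (Ne.symm hfe)
    simp only [row] at this
    linear_combination this
  set T₀ : Finset (Fin 4 × Fin 4) := ({w} : Finset (Fin 4)) ×ˢ Finset.univ with hT₀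
  have hmemT₀ : ∀ x ∈ T₀, x.1 = w := fun x hx =>
    Finset.mem_singleton.1 (Finset.mem_product.1 hx).1
  have hT₀zero : ∀ x ∈ T₀, a x = 0 := by
    intro x hx
    rw [show x = (w, x.2) from Prod.ext (hmemT₀ x hx) rfl]; exact hw x.2
  have hT₀card : T₀.card = 4 := by
    rw [hT₀, Finset.card_product, Finset.card_singleton, Finset.card_univ, Fintype.card_fin]
  -- the static rule for the three steps
  have hfree : ∀ (f : Fin 4) (S : Finset (Fin 4 × Fin 4)),
      (∀ x ∈ S, x.1 = w ∨ (x.1 = s ∧ x.2 ≠ e ∧ x.2 ≠ f)) →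
      ∀ x ∈ S, x.1 ∈ insert s ({r} : Finset (Fin 4)) →
        x.2 ∈ insert f ({e} : Finset (Fin 4)) → False := by
    intro f S hS x hx hx1 hx2
    simp only [Finset.mem_insert, Finset.mem_singleton] at hx1 hx2
    rcases hS x hx with h | ⟨-, hxe, hxf⟩
    · rw [h] at hx1; exact hx1.elim hws hwr
    · exact hx2.elim hxf hxe
  have hS₀ : ∀ x ∈ T₀, x.1 = w ∨ (x.1 = s ∧ x.2 ≠ e ∧ x.2 ≠ f₁) := fun x hx =>
    Or.inl (hmemT₀ x hx)
  have hS₁ : ∀ x ∈ insert (s, f₁) T₀, x.1 = w ∨ (x.1 = s ∧ x.2 ≠ e ∧ x.2 ≠ f₂) := by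
    intro x hx
    rcases Finset.mem_insert.1 hx with h | h
    · rw [h]; exact Or.inr ⟨rfl, Ne.symm h1, h12⟩
    · exact Or.inl (hmemT₀ x h)
  have hS₂ : ∀ x ∈ insert (s, f₂) (insert (s, f₁) T₀),
      x.1 = w ∨ (x.1 = s ∧ x.2 ≠ e ∧ x.2 ≠ f₃) := by
    intro x hx
    rcases Finset.mem_insert.1 hx with h | h
    · rw [h]; exact Or.inr ⟨rfl, Ne.symm h2, h23⟩
    rcases Finset.mem_insert.1 h with h | h
    · rw [h]; exact Or.inr ⟨rfl, Ne.symm h1, h13⟩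
    · exact Or.inl (hmemT₀ x h)
  have st₁ := step_pair (K := K) a T₀ (Ne.symm hrs) (Ne.symm h1) (hfree f₁ _ hS₀) (hp f₁ (Ne.symm h1)) he
  have st₂ := step_pair (K := K) a (insert (s, f₁) T₀) (Ne.symm hrs) (Ne.symm h2)
    (hfree f₂ _ hS₁) (hp f₂ (Ne.symm h2)) he
  have st₃ := step_pair (K := K) a (insert (s, f₂) (insert (s, f₁) T₀)) (Ne.symm hrs)
    (Ne.symm h3) (hfree f₃ _ hS₂) (hp f₃ (Ne.symm h3)) he
  have c1 := natCast_succ_le (n := 0) (by simp) st₃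
  have c2 := natCast_succ_le c1 st₂
  have c3 := natCast_succ_le c2 st₁
  have h := chain_close (K := K) a T₀ hT₀zero c3
  rw [hT₀card] at h
  exact_mod_cast h

/-- **[PROVED v2.1] leaf stub Z.S2 — common zero column of `u, v` (S; 7 zeros).**  Zero row `w`;
`a_{rj} = a_{sj} = 0` and an arm `B_{jc} ≠ 0` (`c ≠ j`).  Then `p_{jx}(a_r,a_s) = 0` for all `x`, so
`B = B(a_r,a_s)` is supported on row/column `j` (STAR shape), `(B a_t)_c = B_{cj} a_{tj}`
(`B` symmetric) and `stub_compound_mulVec` gives `a_{tj} = 0` (domain).  ZEROS: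
`({w} × [4]) ∪ ([4] × {j})`, `4 + 3 = 7` cells; conclude with `card_le_height_ker_aeval`. -/
theorem stub_Z_S2 (a : Fin 4 × Fin 4 → L) (hvan : SubpermVanish a) {w r s t : Fin 4}
    (hwr : w ≠ r) (hws : w ≠ s) (hwt : w ≠ t) (hrs : r ≠ s) (hrt : r ≠ t) (hst : s ≠ t)
    (hw : ∀ c, a (w, c) = 0) {j c : Fin 4} (hcj : c ≠ j) (hrj : a (r, j) = 0)
    (hsj : a (s, j) = 0) (harm : compound (row a r) (row a s) j c ≠ 0) :
    (7 : ℕ∞) ≤ (RingHom.ker (aeval (R := K) a)).height := by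
  classical
  have hC : compound (row a r) (row a s) *ᵥ row a t = 0 := stub_compound_mulVec a hvan hrs hrt hst
  have htj : a (t, j) = 0 := by
    have hc := congrFun hC c
    revert hcj hrj hsj harm hc
    fin_cases j <;> fin_cases c <;> intro hcj hrj hsj harm hc
    all_goals first
      | exact absurd rfl hcj
      | simp_all [compound_explicit, Matrix.mulVec, dotProduct, Fin.sum_univ_four, row]
  have hcard : ∀ w j : Fin 4, 7 ≤ ((({w} : Finset (Fin 4)) ×ˢ (Finset.univ : Finset (Fin 4))) ∪
      ((Finset.univ : Finset (Fin 4)) ×ˢ ({j} : Finset (Fin 4)))).card := by decide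
  refine le_trans ?_ (card_le_height_ker_aeval (K := K) a
    ((({w} : Finset (Fin 4)) ×ˢ (Finset.univ : Finset (Fin 4))) ∪
      ((Finset.univ : Finset (Fin 4)) ×ˢ ({j} : Finset (Fin 4)))) ?_)
  · exact_mod_cast hcard w j
  · rintro ⟨i, x⟩ hx
    rcases Finset.mem_union.1 hx with h | h
    · have hi : i = w := by simpa using (Finset.mem_product.1 h).1
      rw [hi]; exact hw x
    · have hx' : x = j := by simpa using (Finset.mem_product.1 h).2
      rw [hx']
      rcases cover4 w r s t hwr hws hwt hrs hrt hst i with h | h | h | h <;> rw [h]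
      exacts [hw j, hrj, hsj, htj]

/-- **[PROVED v2.1] leaf stub Z.S1a — STAR with a live centre (S–M; chain length 8, slack 1).**  Zero row `w`;
`a_{rj} ≠ 0`; the STAR relations `p_{jx}(a_r,a_s) = a_{rj}a_{sx} + a_{rx}a_{sj} = 0` (`x ≠ j`); an
arm `B_{jc} ≠ 0` (`c ≠ j`; `B_{jc} = p_{ef}(a_r,a_s)`, `{j,c,e,f} = [4]`).  CHAIN:
`T₀ = {w} × [4]` (4); step 5 frees `(t, c)` with the `3 × 3` witness = subpermanent of the generic
matrix on rows `{r,s,t}`, columns `≠ j` (`aeval_blockWitness_of_mem` with `Rw = {r,s}`, `i' = t`,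
`Cl = {e,f}`, `j' = c`): lead coefficient `per[{r,s}|{e,f}](a) = B_{jc} ≠ 0`, value at `a` = the
hypothesis `hvan w j`, support rows `r,s,t` × columns `≠ j` — disjoint from `T₀`; steps 6–8 free
`(s, x)` for the three `x ≠ j` with witness `p_{jx}(X_r,X_s)` (`Rw = {r}`, `i' = s`, `Cl = {j}`,
`j' = x`): lead `a_{rj} ≠ 0`, value `0` by STAR, support `{r,s} × {j,x}` — disjoint from `T₀`,
from `(t,c)` and from the earlier `(s,x')` (`(s,j)` is never freed).  `4 + 1 + 3 = 8 ≥ 7`. -/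
theorem stub_Z_S1a (a : Fin 4 × Fin 4 → L) (hvan : SubpermVanish a) {w r s t : Fin 4}
    (hwr : w ≠ r) (hws : w ≠ s) (hwt : w ≠ t) (hrs : r ≠ s) (hrt : r ≠ t) (hst : s ≠ t)
    (hw : ∀ c, a (w, c) = 0) {j c : Fin 4} (hcj : c ≠ j) (hrj : a (r, j) ≠ 0)
    (hstar : ∀ x, x ≠ j → a (r, j) * a (s, x) + a (r, x) * a (s, j) = 0)
    (harm : compound (row a r) (row a s) j c ≠ 0) :
    (7 : ℕ∞) ≤ (RingHom.ker (aeval (R := K) a)).height := by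
  classical
  obtain ⟨e, f, hef, hej, hec, hfj, hfc⟩ := others2 j c (Ne.symm hcj)
  have hlead : a (r, e) * a (s, f) + a (r, f) * a (s, e) ≠ 0 := by
    have h := compound_apply_of_ne (row a r) (row a s) (Ne.symm hcj) (Ne.symm hej) (Ne.symm hfj)
      (Ne.symm hec) (Ne.symm hfc) hef
    simp only [row] at h
    rwa [h] at harm
  have hp : ∀ x, x ≠ j → a (s, x) * a (r, j) + a (s, j) * a (r, x) = 0 := by
    intro x hx; linear_combination hstar x hx
  set T₀ : Finset (Fin 4 × Fin 4) := ({w} : Finset (Fin 4)) ×ˢ Finset.univ with hT₀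
  have hmemT₀ : ∀ x ∈ T₀, x.1 = w := fun x hx =>
    Finset.mem_singleton.1 (Finset.mem_product.1 hx).1
  have hT₀zero : ∀ x ∈ T₀, a x = 0 := by
    intro x hx
    rw [show x = (w, x.2) from Prod.ext (hmemT₀ x hx) rfl]; exact hw x.2
  have hT₀card : T₀.card = 4 := by
    rw [hT₀, Finset.card_product, Finset.card_singleton, Finset.card_univ, Fintype.card_fin]
  -- step 5: free `(t, c)` with the `3 × 3` witness
  have st₀ := step_three (K := K) a hvan T₀ hwr hws hwt hrs hrt hst (Ne.symm hcj) (Ne.symm hej)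
    (Ne.symm hfj) (Ne.symm hec) (Ne.symm hfc) hef hmemT₀ hlead
  -- steps 6–8: free `(s, c)`, `(s, e)`, `(s, f)` with the `2 × 2` witnesses `p_{jx}(X_r, X_s)`
  set T₁ : Finset (Fin 4 × Fin 4) := insert (t, c) T₀ with hT₁
  have hmemT₁ : ∀ x ∈ T₁, x.1 = w ∨ x.1 = t := by
    intro x hx
    rcases Finset.mem_insert.1 hx with h | h
    · rw [h]; exact Or.inr rfl
    · exact Or.inl (hmemT₀ x h)
  have hfree : ∀ (x : Fin 4) (S : Finset (Fin 4 × Fin 4)),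
      (∀ y ∈ S, (y.1 = w ∨ y.1 = t) ∨ (y.1 = s ∧ y.2 ≠ j ∧ y.2 ≠ x)) →
      ∀ y ∈ S, y.1 ∈ insert s ({r} : Finset (Fin 4)) →
        y.2 ∈ insert x ({j} : Finset (Fin 4)) → False := by
    intro x S hS y hy hy1 hy2
    simp only [Finset.mem_insert, Finset.mem_singleton] at hy1 hy2
    rcases hS y hy with (h | h) | ⟨-, hyj, hyx⟩
    · rw [h] at hy1; exact hy1.elim hws hwr
    · rw [h] at hy1; exact hy1.elim (Ne.symm hst) (Ne.symm hrt)
    · exact hy2.elim hyx hyj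
  have hS₁ : ∀ y ∈ T₁, (y.1 = w ∨ y.1 = t) ∨ (y.1 = s ∧ y.2 ≠ j ∧ y.2 ≠ c) := fun y hy =>
    Or.inl (hmemT₁ y hy)
  have hS₂ : ∀ y ∈ insert (s, c) T₁, (y.1 = w ∨ y.1 = t) ∨ (y.1 = s ∧ y.2 ≠ j ∧ y.2 ≠ e) := by
    intro y hy
    rcases Finset.mem_insert.1 hy with h | h
    · rw [h]; exact Or.inr ⟨rfl, hcj, Ne.symm hec⟩
    · exact Or.inl (hmemT₁ y h)
  have hS₃ : ∀ y ∈ insert (s, e) (insert (s, c) T₁),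
      (y.1 = w ∨ y.1 = t) ∨ (y.1 = s ∧ y.2 ≠ j ∧ y.2 ≠ f) := by
    intro y hy
    rcases Finset.mem_insert.1 hy with h | h
    · rw [h]; exact Or.inr ⟨rfl, hej, hef⟩
    rcases Finset.mem_insert.1 h with h | h
    · rw [h]; exact Or.inr ⟨rfl, hcj, Ne.symm hfc⟩
    · exact Or.inl (hmemT₁ y h)
  have st₁ := step_pair (K := K) a T₁ (Ne.symm hrs) hcj (hfree c _ hS₁) (hp c hcj) hrj
  have st₂ := step_pair (K := K) a (insert (s, c) T₁) (Ne.symm hrs) hej (hfree e _ hS₂)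
    (hp e hej) hrj
  have st₃ := step_pair (K := K) a (insert (s, e) (insert (s, c) T₁)) (Ne.symm hrs) hfj
    (hfree f _ hS₃) (hp f hfj) hrj
  have c1 := natCast_succ_le (n := 0) (by simp) st₃
  have c2 := natCast_succ_le c1 st₂
  have c3 := natCast_succ_le c2 st₁
  have c4 := natCast_succ_le c3 st₀
  have h := chain_close (K := K) a T₀ hT₀zero c4
  rw [hT₀card] at h
  exact le_trans (by exact_mod_cast (by norm_num : (7 : ℕ) ≤ 4 + 4)) h

/-- core of leaf Z.K with the live entry named -/
theorem Z_K_core (a : Fin 4 × Fin 4 → L) {w r s : Fin 4}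
    (hwr : w ≠ r) (hws : w ≠ s) (hrs : r ≠ s)
    (hw : ∀ c, a (w, c) = 0) {α β γ δ : Fin 4} (hαβ : α ≠ β) (hαγ : α ≠ γ) (hαδ : α ≠ δ)
    (hβγ : β ≠ γ) (hβδ : β ≠ δ) (hγδ : γ ≠ δ) (hα : a (r, α) = 0) (hβ : a (r, β) = 0)
    (hγ : a (r, γ) ≠ 0) (hrel : a (r, γ) * a (s, δ) + a (r, δ) * a (s, γ) = 0) :
    (7 : ℕ∞) ≤ (RingHom.ker (aeval (R := K) a)).height := by
  classical
  set T₀ : Finset (Fin 4 × Fin 4) :=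
    insert (r, α) (insert (r, β) (({w} : Finset (Fin 4)) ×ˢ Finset.univ)) with hT₀
  have hmemT₀ : ∀ x ∈ T₀, x = (r, α) ∨ x = (r, β) ∨ x.1 = w := by
    intro x hx
    rcases Finset.mem_insert.1 hx with h | h
    · exact Or.inl h
    rcases Finset.mem_insert.1 h with h | h
    · exact Or.inr (Or.inl h)
    · exact Or.inr (Or.inr (Finset.mem_singleton.1 (Finset.mem_product.1 h).1))
  have hT₀zero : ∀ x ∈ T₀, a x = 0 := by
    intro x hx
    rcases hmemT₀ x hx with h | h | h
    · rw [h]; exact hα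
    · rw [h]; exact hβ
    · rw [show x = (w, x.2) from Prod.ext h rfl]; exact hw x.2
  have hT₀card : T₀.card = 6 := by
    rw [hT₀, Finset.card_insert_of_notMem, Finset.card_insert_of_notMem, Finset.card_product,
      Finset.card_singleton, Finset.card_univ, Fintype.card_fin]
    · intro h
      exact hwr.symm (Finset.mem_singleton.1 (Finset.mem_product.1 h).1)
    · intro h
      rcases Finset.mem_insert.1 h with h | h
      · exact hαβ (congrArg Prod.snd h)
      · exact hwr.symm (Finset.mem_singleton.1 (Finset.mem_product.1 h).1)
  have hfree : ∀ x ∈ T₀, x.1 ∈ insert s ({r} : Finset (Fin 4)) →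
      x.2 ∈ insert δ ({γ} : Finset (Fin 4)) → False := by
    intro x hx h1 h2
    simp only [Finset.mem_insert, Finset.mem_singleton] at h1 h2
    rcases hmemT₀ x hx with h | h | h
    · rw [h] at h2; exact h2.elim hαδ hαγ
    · rw [h] at h2; exact h2.elim hβδ hβγ
    · rw [h] at h1; exact h1.elim hws hwr
  have hstep := step_pair (K := K) a T₀ (Ne.symm hrs) (Ne.symm hγδ) hfree
    (by linear_combination hrel) hγ
  have h1 := natCast_succ_le (n := 0) (by simp) hstep
  have h := chain_close (K := K) a T₀ hT₀zero h1
  rw [hT₀card] at h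
  exact_mod_cast h

/-- **[PROVED v2.1] leaf stub Z.K — the K₂₂ pattern (S; chain length exactly 7).**  Zero row `w`; row `r` has
`a_{rα} = a_{rβ} = 0` and is not zero (so `a_{rγ} ≠ 0` or `a_{rδ} ≠ 0`); the relation
`p_{γδ}(a_r,a_s) = a_{rγ}a_{sδ} + a_{rδ}a_{sγ} = 0`; `{α,β,γ,δ} = [4]`.  CHAIN:
`T₀ = {w} × [4] ∪ {(r,α),(r,β)}` (6 zeros); step 7 frees `(s, δ)` if `a_{rγ} ≠ 0` (else `(s, γ)`,
symmetric) with witness `p_{γδ}(X_r,X_s)` (`Rw = {r}`, `i' = s`, `Cl = {γ}`, `j' = δ`): lead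
`a_{rγ} ≠ 0`, value `0`, support `{r,s} × {γ,δ}` disjoint from `T₀`.  `6 + 1 = 7`. -/
theorem stub_Z_K (a : Fin 4 × Fin 4 → L) (_hvan : SubpermVanish a) {w r s t : Fin 4}
    (hwr : w ≠ r) (hws : w ≠ s) (_hwt : w ≠ t) (hrs : r ≠ s) (_hrt : r ≠ t) (_hst : s ≠ t)
    (hw : ∀ c, a (w, c) = 0) {α β γ δ : Fin 4} (hαβ : α ≠ β) (hαγ : α ≠ γ) (hαδ : α ≠ δ)
    (hβγ : β ≠ γ) (hβδ : β ≠ δ) (hγδ : γ ≠ δ) (hα : a (r, α) = 0) (hβ : a (r, β) = 0)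
    (hr0 : ∃ c, a (r, c) ≠ 0) (hrel : a (r, γ) * a (s, δ) + a (r, δ) * a (s, γ) = 0) :
    (7 : ℕ∞) ≤ (RingHom.ker (aeval (R := K) a)).height := by
  obtain ⟨c0, hc0⟩ := hr0
  by_cases hγ : a (r, γ) = 0
  · have hδ : a (r, δ) ≠ 0 := by
      rcases cover4 α β γ δ hαβ hαγ hαδ hβγ hβδ hγδ c0 with h | h | h | h <;> rw [h] at hc0
      · exact absurd hα hc0
      · exact absurd hβ hc0
      · exact absurd hγ hc0
      · exact hc0
    exact Z_K_core (K := K) a hwr hws hrs hw hαβ hαδ hαγ hβδ hβγ (Ne.symm hγδ) hα hβ hδ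
      (by linear_combination hrel)
  · exact Z_K_core (K := K) a hwr hws hrs hw hαβ hαγ hαδ hβγ hβδ hγδ hα hβ hγ hrel

/-! #### PROVED: leaf Z0, the dispatch over the zero-line branch, and the cascade's top level -/

/-- **Leaf Z0 (PROVED): two zero rows give eight vanishing coordinates, `8 ≥ 7`.** -/
theorem seven_le_height_of_two_zero_rows (a : Fin 4 × Fin 4 → L) {w w' : Fin 4} (hww : w ≠ w')
    (hw : ∀ c, a (w, c) = 0) (hw' : ∀ c, a (w', c) = 0) :
    (7 : ℕ∞) ≤ (RingHom.ker (aeval (R := K) a)).height := by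
  classical
  refine le_trans ?_
    (card_le_height_ker_aeval (K := K) a (({w, w'} : Finset (Fin 4)) ×ˢ Finset.univ) ?_)
  · rw [Finset.card_product, Finset.card_pair hww, Finset.card_univ, Fintype.card_fin]
    exact_mod_cast (by norm_num : 7 ≤ 2 * 4)
  · rintro ⟨x, c⟩ hx
    have hx1 : x ∈ ({w, w'} : Finset (Fin 4)) := (Finset.mem_product.1 hx).1
    rcases Finset.mem_insert.1 hx1 with h | h
    · rw [h]; exact hw c
    · rw [Finset.mem_singleton.1 h]; exact hw' c

/-- **The zero-ROW branch assembles from the leaves (PROVED dispatch; inherits the leaf/support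
stubs' `sorry`s, introduces none).**  Second zero row → Z0; else `B = B(a_r,a_s)`:
`adj B ≠ 0` → Z.R3; `B = 0` → Z.B0; `B ≠ 0 = adj B` → classification → Z.S2 / Z.S1a / Z.K. -/
theorem seven_le_height_of_zeroRow (h2 : (2 : K) ≠ 0) (a : Fin 4 × Fin 4 → L)
    (hvan : SubpermVanish a) {w : Fin 4} (hw : ∀ c, a (w, c) = 0) :
    (7 : ℕ∞) ≤ (RingHom.ker (aeval (R := K) a)).height := by
  classical
  obtain ⟨r, s, t, hwr, hws, hwt, hrs, hrt, hst⟩ := others4 w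
  by_cases hr0 : ∀ c, a (r, c) = 0
  · exact seven_le_height_of_two_zero_rows a hwr hw hr0
  by_cases hs0 : ∀ c, a (s, c) = 0
  · exact seven_le_height_of_two_zero_rows a hws hw hs0
  have hu : row a r ≠ 0 := fun h => hr0 fun c => congrFun h c
  have hv : row a s ≠ 0 := fun h => hs0 fun c => congrFun h c
  by_cases hadj : (compound (row a r) (row a s)).adjugate = 0
  · by_cases hB : compound (row a r) (row a s) = 0
    · obtain ⟨e, he⟩ := not_forall.1 hr0
      exact stub_Z_compoundZero a hvan hwr hws hwt hrs hrt hst hw hB he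
    · rcases stub_rankTwo_classification h2 hu hv hB hadj with
        ⟨j, c, hcj, huj, hvj, harm⟩ | ⟨j, c, hcj, huj, hstar, harm⟩ |
        ⟨α, β, γ, δ, hαβ, hαγ, hαδ, hβγ, hβδ, hγδ, hzero, hrel⟩
      · exact stub_Z_S2 a hvan hwr hws hwt hrs hrt hst hw hcj huj hvj harm
      · exact stub_Z_S1a a hvan hwr hws hwt hrs hrt hst hw hcj huj hstar harm
      · rcases hzero with ⟨hα, hβ⟩ | ⟨hα, hβ⟩
        · exact stub_Z_K a hvan hwr hws hwt hrs hrt hst hw hαβ hαγ hαδ hβγ hβδ hγδ hα hβ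
            (not_forall.1 hr0) hrel
        · exact stub_Z_K a hvan hws hwr hwt hrs.symm hst hrt hw hαβ hαγ hαδ hβγ hβδ hγδ hα hβ
            (not_forall.1 hs0) (by simp only [row] at hrel; linear_combination hrel)
  · obtain ⟨m, k, hmk⟩ : ∃ m k, (compound (row a r) (row a s)).adjugate m k ≠ 0 := by
      by_contra h
      push Not at h
      exact hadj (Matrix.ext fun m k => h m k)
    exact stub_Z_kerline a hvan hwr hws hwt hrs hrt hst hw hmk

/-- **The zero-LINE branch (PROVED from the above + the two transposition stubs).** -/
theorem seven_le_height_of_zeroLine (h2 : (2 : K) ≠ 0) (a : Fin 4 × Fin 4 → L)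
    (hvan : SubpermVanish a) (hz : HasZeroLine a) :
    (7 : ℕ∞) ≤ (RingHom.ker (aeval (R := K) a)).height := by
  rcases hz with ⟨w, hw⟩ | ⟨c, hc⟩
  · exact seven_le_height_of_zeroRow h2 a hvan hw
  · rw [← stub_height_transpose (K := K) a]
    exact seven_le_height_of_zeroRow h2 (fun x : Fin 4 × Fin 4 => a (x.2, x.1))
      (stub_subpermVanish_transpose a hvan) (w := c) fun r => hc r

/-- **The cascade's top level (PROVED, no sorry of its own): zero line → `hZ`; no zero line →
eight zeros (`hNZ`) → height `≥ 8 ≥ 7` by `VonZurGathen.card_le_height_ker_aeval`.** -/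
theorem seven_le_height_of_vanishing_of
    (hZ : ∀ a : Fin 4 × Fin 4 → L, SubpermVanish a → HasZeroLine a →
      (7 : ℕ∞) ≤ (RingHom.ker (aeval (R := K) a)).height)
    (hNZ : ∀ a : Fin 4 × Fin 4 → L, SubpermVanish a → ¬ HasZeroLine a →
      ∃ Z : Finset (Fin 4 × Fin 4), 8 ≤ Z.card ∧ ∀ x ∈ Z, a x = 0)
    (a : Fin 4 × Fin 4 → L) (hvan : SubpermVanish a) :
    (7 : ℕ∞) ≤ (RingHom.ker (aeval (R := K) a)).height := by
  by_cases hz : HasZeroLine a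
  · exact hZ a hvan hz
  · obtain ⟨Z, hcard, hZ0⟩ := hNZ a hvan hz
    calc (7 : ℕ∞) ≤ 8 := by norm_num
      _ ≤ (Z.card : ℕ∞) := by exact_mod_cast hcard
      _ ≤ _ := card_le_height_ker_aeval a Z hZ0

/-- The point-form bound from the stubs themselves (inherits their `sorry`s, introduces none). -/
theorem seven_le_height_of_vanishing (h2 : (2 : K) ≠ 0) (h3 : (3 : K) ≠ 0)
    (a : Fin 4 × Fin 4 → L) (hvan : SubpermVanish a) :
    (7 : ℕ∞) ≤ (RingHom.ker (aeval (R := K) a)).height :=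
  seven_le_height_of_vanishing_of (seven_le_height_of_zeroLine h2) (stub_noZeroLine_zeros h2 h3)
    a hvan

/-- **Point form from the support theorem statement (PROVED, no `sorry` in its cone).** -/
theorem seven_le_height_of_vanishing_of_support (hS : SupportTheorem L) (h2 : (2 : K) ≠ 0)
    (h3 : (3 : K) ≠ 0) (a : Fin 4 × Fin 4 → L) (hvan : SubpermVanish a) :
    (7 : ℕ∞) ≤ (RingHom.ker (aeval (R := K) a)).height :=
  seven_le_height_of_vanishing_of (seven_le_height_of_zeroLine h2)
    (noZeroLine_zeros_of_support hS h2 h3) a hvan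

end Cascade

/-! ### §3 Assembly over `ℂ`: prime form, the height inequality, and the rung BY NAME (v1 glue,
unchanged but for `3 ≠ 0`) -/

/-- Prime form from point form at `K = ℂ` (generic point of a prime; the ten lines of
`AlperBogartVelasco.five_le_height_of_singPermIdeal_le` with `5 ↦ 7`). PROVED. -/
theorem seven_le_height_of_singPermIdeal_le
    (hpt : ∀ (L : Type) [CommRing L] [IsDomain L] [Algebra ℂ L] (a : Fin 4 × Fin 4 → L),
      SubpermVanish a → (7 : ℕ∞) ≤ (RingHom.ker (aeval (R := ℂ) a)).height)
    (P : Ideal (MvPolynomial (Fin 4 × Fin 4) ℂ)) [hP : P.IsPrime]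
    (hle : singPermIdeal ℂ 4 ≤ P) : (7 : ℕ∞) ≤ P.height := by
  let a : Fin 4 × Fin 4 → MvPolynomial (Fin 4 × Fin 4) ℂ ⧸ P := fun x => Ideal.Quotient.mk P (X x)
  have hker : RingHom.ker (aeval (R := ℂ) a) = P := by
    have h : (aeval (R := ℂ) a : MvPolynomial (Fin 4 × Fin 4) ℂ →ₐ[ℂ] _ ⧸ P) =
        Ideal.Quotient.mkₐ ℂ P :=
      MvPolynomial.algHom_ext fun x => by simp [a]
    ext f
    rw [RingHom.mem_ker, show aeval (R := ℂ) a f = Ideal.Quotient.mk P f by rw [h]; rfl,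
      Ideal.Quotient.eq_zero_iff_mem]
  have hvan1 : SubpermVanish a := by
    intro r c
    rw [← aeval_subperm_X (K := ℂ) a, ← pderiv_perPoly, ← RingHom.mem_ker, hker]
    exact hle (pderiv_perPoly_mem_singPermIdeal ℂ 4 (r, c))
  rw [← hker]
  exact hpt _ a hvan1

/-- **«codim Sing(per₄) ≥ 7» from the point form (PROVED glue):** the hypothesis of the landed
`strengthTwoPerFourGeFour_of_seven_le_height`, in its own currency
`(singIdeal (perPoly (Fin 4) ℂ)).height` (`= singPermIdeal ℂ 4` by `singIdeal_perPoly`, `rfl`). -/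
theorem seven_le_height_singIdeal_perPoly_four_of
    (hpt : ∀ (L : Type) [CommRing L] [IsDomain L] [Algebra ℂ L] (a : Fin 4 × Fin 4 → L),
      SubpermVanish a → (7 : ℕ∞) ≤ (RingHom.ker (aeval (R := ℂ) a)).height) :
    (7 : ℕ∞) ≤ (singIdeal (perPoly (Fin 4) ℂ)).height := by
  rw [singIdeal_perPoly, Ideal.height_eq_inf_minimalPrimes]
  refine le_iInf₂ fun P hP => ?_
  haveI := hP.1.1
  exact seven_le_height_of_singPermIdeal_le hpt P hP.1.2

/-- **The rung, unfolded, BY NAME through the landed helper (PROVED glue):** point form ⇒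
`str₂(per₄) ≥ 4` in exactly the statement of
`PolyaContinuedLaplaceRigidity.Strength.strengthTwoPerFourGeFour_of_seven_le_height`. -/
theorem strengthTwoPerFourGeFour_unfolded_of
    (hpt : ∀ (L : Type) [CommRing L] [IsDomain L] [Algebra ℂ L] (a : Fin 4 × Fin 4 → L),
      SubpermVanish a → (7 : ℕ∞) ≤ (RingHom.ker (aeval (R := ℂ) a)).height) :
    ∀ p q : Fin 3 → MvPolynomial (Fin 4 × Fin 4) ℂ,
      ¬ ((∀ i, (p i).IsHomogeneous 2) ∧ (∀ i, (q i).IsHomogeneous 2) ∧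
        perPoly (Fin 4) ℂ = ∑ i, p i * q i) :=
  strengthTwoPerFourGeFour_of_seven_le_height (seven_le_height_singIdeal_perPoly_four_of hpt)

/-! ### The workfile's names (verbatim)
`Lines/laplace_rigidity.lean` is a crux workfile, not an importable module, so — as
`laplace_rigidity_supports.lean` does — its two declarations are copied VERBATIM
(`LaplaceRigidity.IsTwoFactorDecomp` l.46–48, `LaplaceRigidity.StrengthTwoPerFourGeFour` l.355–357);
with both files in one session the identification is `Iff.rfl`. -/

/-- VERBATIM copy of `LaplaceRigidity.IsTwoFactorDecomp`. -/
def IsTwoFactorDecomp (n k w : ℕ) (p q : Fin w → MvPolynomial (Fin n × Fin n) ℂ) : Prop :=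
  (∀ i, (p i).IsHomogeneous k) ∧ (∀ i, (q i).IsHomogeneous (n - k)) ∧
    Literature.Computability.AlgebraicComplexity.perPoly (Fin n) ℂ = ∑ i, p i * q i

/-- VERBATIM copy of `LaplaceRigidity.StrengthTwoPerFourGeFour` («str₂(per₄) ≥ 4»). -/
def StrengthTwoPerFourGeFour : Prop :=
  ∀ p q : Fin 3 → MvPolynomial (Fin 4 × Fin 4) ℂ, ¬ IsTwoFactorDecomp 4 2 3 p q

/-- **Composition to the rung's name (PROVED glue, no sorry of its own).** -/
theorem strengthTwoPerFourGeFour_of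
    (hpt : ∀ (L : Type) [CommRing L] [IsDomain L] [Algebra ℂ L] (a : Fin 4 × Fin 4 → L),
      SubpermVanish a → (7 : ℕ∞) ≤ (RingHom.ker (aeval (R := ℂ) a)).height) :
    StrengthTwoPerFourGeFour := fun p q h =>
  strengthTwoPerFourGeFour_unfolded_of hpt p q h

/-- The skeleton closes from the stubs (this declaration inherits their `sorry`s and
introduces none): `StrengthTwoPerFourGeFour`. -/
theorem strengthTwoPerFourGeFour_of_stubs : StrengthTwoPerFourGeFour :=
  strengthTwoPerFourGeFour_of fun L _ _ _ a hvan =>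
    seven_le_height_of_vanishing (K := ℂ) (L := L) two_ne_zero (by norm_num) a hvan

/-- **v2.2 MAIN OUTPUT (PROVED; `sorry`-free cone — every stub it uses is proved in this
file): the rung `StrengthTwoPerFourGeFour` («str₂(per₄) ≥ 4») follows from the STATEMENT of
val-idea-10 g2's support theorem for `Sing(per₄)` (over every domain that is a `ℂ`-algebra; its
author's proof is characteristic-free given `12 ≠ 0`).**  Not a summit statement; the HELD crux
`CoverDecancellation` is untouched. -/
theorem strengthTwoPerFourGeFour_of_support
    (hS : ∀ (L : Type) [CommRing L] [IsDomain L], SupportTheorem L) : StrengthTwoPerFourGeFour :=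
  strengthTwoPerFourGeFour_of fun L _ _ _ a hvan =>
    seven_le_height_of_vanishing_of_support (K := ℂ) (L := L) (hS L) two_ne_zero (by norm_num) a hvan

/-- **v2.3 FINAL OUTPUT (PROVED, no `sorry` anywhere in this file): the rung
`StrengthTwoPerFourGeFour` — `per₄` is not a sum of three products of two quadrics («str₂(per₄) ≥ 4»).**
A crux-workfile theorem about one fixed polynomial; NOT a summit statement: `CoverDecancellation`
(stmt-17819) stays HELD and untouched, `StrengthTwoPerFour` (stmt-25160, width 5) is untouched, VP ≠ VNP
is not proved. -/
theorem strengthTwoPerFourGeFour_holds : StrengthTwoPerFourGeFour :=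
  strengthTwoPerFourGeFour_of_stubs

/-- **v2.3, in the tree's own currency (PROVED): `codim Sing(per₄) ≥ 7`, i.e.
`7 ≤ height (singIdeal per₄)` over `ℂ`.**  (Method ceiling: the true value is `8`,
`alperBogartVelasco2017_rem_1_5`; an independent workfile-level proof is val-idea-10 g2's
`Lines/sing_per4_height.lean`.) -/
theorem seven_le_height_singIdeal_perPoly_four :
    (7 : ℕ∞) ≤ (singIdeal (perPoly (Fin 4) ℂ)).height :=
  seven_le_height_singIdeal_perPoly_four_of fun L _ _ _ a hvan =>
    seven_le_height_of_vanishing (K := ℂ) (L := L) two_ne_zero (by norm_num) a hvan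

end Summit.ValiantsHypothesis.ValiantsHypothesis.Cruxes.CoverDecancellation.SingHeightCascade

end
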